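import Mathlib
import Literature.MathematicalPhysics.QuantumFieldTheory.Balaban1983to89.B4Thm110ZeroBox

/-!
# B4 §1 (1.2)–(1.6): the covariant lattice operators WITH external gauge field, their GAUGE COVARIANCE, and the
printed reductions «constant configuration `A₀` ⇒ `A₀ = 0`» (pp. 580–582) — kernel theorems

Bałaban, *Regularity and decay of lattice Green's functions*, Commun. Math. Phys. **89** (1983) 571–597 (`B4`;
journal page = PDF page + 570).  This is the first module of the `B4*` lineage whose objects carry a NON-ZERO
vector field `A`: every earlier `B4*` leaf (`B4`, `B4Prop31Zero`, `B4Cor23Zero*`, `B4Lemma21Zero`, `B4Claim18Zero`,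
`B4BoxCov237`, `B4Thm110ZeroBox*`, …) works at `A = 0`.

## The print (verbatim, p. 572 [PDF 2] unless marked)

Vector fields (p. 572, paraphrase): real-valued functions on the bonds `⟨x, x'⟩`, identified with vector-valued
functions on sites by `A_{⟨x,x+ηe_μ⟩} = A_μ(x)`.
(1.2) «`U(A) = e^{qeηA}`, `q` is an antisymmetric `N × N` matrix, where `e` is a real parameter.»
(1.3) «`⟨φ, (−Δ^{η,N}_{A,Ω})φ⟩ = Σ_{b⊂Ω} η^d |(D^η_Aφ)(b)|² = Σ_{b⊂Ω} η^d |η^{−1}(U(A_b)φ(b₊) − φ(b₋))|²`,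
`φ : Ω → R^N`»; «summation is over the set of all bonds `b = ⟨b₋,b₊⟩` with end-points `b₋, b₊` in `Ω`» (Neumann).
(1.4) «`(Q_k(A)φ)(y) = Σ_{x∈B^k(y)} η^d U(A(Γ^{(k)}_{y,x})) φ(x)`, `y ∈ Z^d`»; `Γ^{(k)}_{y,x}` oriented contours in
`B^k(y)` from `y` to `x`; «`A(Γ) = Σ_{b⊂Γ} A_b`» (orientations agreeing, `−A_b` otherwise).
(1.5) «`P_k(A) = Q_k^*(A) Q_k(A)`».   (1.6) «`G_k(Ω, A) = (−Δ^{η,N}_{A,Ω} + m² + aP_k(A))^{−1}`, where `m² ≥ 0` and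
`a` is a positive constant close to 1.»
p. 580 [PDF 10] (proof of Lemma 2.1, the bounds (2.25) for `G_k(□, A₀)`, `A₀` constant): «Using the same gauge
transformation as in the proof of Lemma 2.4, we reduce them to the case `A₀ = 0`.»
p. 581 [PDF 11] (proof of Lemma 2.2): «Lemma 2.2 in the case of a constant configuration `A₀` is equivalent to the
case of configuration `A₀ = 0` by the same argument with the gauge transformation as before. Thus we have reduced the
proof of this lemma to a proof of the» p. 582 [PDF 12] «corresponding properties for the propagator `G_k(□,0)`, or to
the one-component propagator `G_k(□)` [`G_k(□,0) = G_k(□)1`, `1` is identity operator on `R^N`].»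
p. 590 [PDF 20]: «we can "gauge away" the configuration `A₀` using the same gauge transformation, and we get the
expression (4.8) with `A₀ = 0` and `φ(x), φ(x')` replaced by `φ(x), U(A₀(⟨x,x'⟩))φ(x')` respectively.»

## What is certified here (kernel theorems; HONEST SCOPE below)

* §1–§3: the operators (1.3)–(1.6) over ARBITRARY link variables `W(x,y) ∈ O(N)` (block-matrix calculus `blockOp`,
  `blockDiag`): `covLap` with ITS QUADRATIC FORM (1.3) AS PRINTED (`covLap_form`:
  `⟨Φ, −Δ_WΦ⟩ = Σ_{x,y} c(x,y)|W(x,y)φ(y) − φ(x)|²`), `avgOp` = (1.4) (`fld_avgOp_mulVec`), `projOp` = (1.5),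
  `covOp`/`green` = (1.6); and their GAUGE COVARIANCE under `φ(x) ↦ g(x)φ(x)`, `W(x,y) ↦ g(x)W(x,y)g(y)ᵀ`,
  `U(A(Γ_{y,x})) ↦ g(y)U(A(Γ_{y,x}))g(x)ᵀ` (`covLap_gauge`, `avgOp_gauge`, `projOp_gauge`, `covOp_gauge`, `green_gauge`,
  `green_mulVec_gauge`: `G(A^g)(𝒢Φ) = 𝒢(G(A)Φ)`).
* §4: parallel transport `U(A(Γ))` along contours (`transport`, `contourTrans`) and ITS covariance
  (`transport_gauge`: `U(A^g(Γ)) = g(start)U(A(Γ))g(end)ᵀ`), whence covariance of (1.6) with the transporters built from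
  the link variables, for every contour system whose contours `Γ_{y,x}` END AT `x` (`covOp_contour_gauge`,
  `green_contour_gauge`).
* §5: the block kernels (`covLap_eq_blockOp`: diagonal `Σ c·(WᵀW) + Σ c·1`, hopping `−cWᵀ`, `−cW`; `projOp_eq_blockOp`)
  and the printed p. 582 identity AT `A = 0`: `H(0) = H_scalar ⊗ 1_N`, `G(0) = G_scalar ⊗ 1_N` (`covOp_trivial`,
  `green_trivial`).
* §6: [B4]'s link variables (1.2) as a ONE-PARAMETER ORTHOGONAL GROUP `t ↦ U(t)` (`OrthFlow`; the `N = 2` rotation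
  flow `OrthFlow.rot` is a non-trivial instance, `rot_ne_one`), vector fields as bond functions, the lattice gauge
  transformation `A ↦ A − ∂λ` (`bondGauge`) with `U(A^λ_b) = U(κλ(b₋))U(A_b)U(κλ(b₊))ᵀ` (`fieldLink_bondGauge`); **a
  constant field is a pure gauge** (`constBond_eq_bondGauge`, `fieldLink_constBond`, `λ = −⟨A₀, ·⟩`); hence the
  printed reductions as EQUALITIES OF OPERATORS: `H(A^λ) = 𝒢H(A)𝒢ᵀ`, `G_k(Ω, A^λ) = 𝒢G_k(Ω, A)𝒢ᵀ` (`b4Op_bondGauge`,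
  `b4Green_bondGauge`), `H(0) = H_scalar ⊗ 1_N` (`b4Op_zero`), `G_k(Ω, A₀) = 𝒢(G_scalar ⊗ 1_N)𝒢ᵀ`
  (`b4Green_constBond`), blockwise `G_k(Ω,A₀)((x,i),(x',j)) = G_scalar(x,x')·(U(κλ(x))U(κλ(x'))ᵀ)_{ij}`
  (`b4Green_constBond_apply`) and the ENTRYWISE DOMINATION `|G_k(Ω,A₀)((x,i),(x',j))| ≤ |G_scalar(x,x')|`
  (`abs_b4Green_constBond_le`) — every zero-field kernel bound transfers verbatim to constant configurations.
* §7: DICTIONARY with the lineage: on the fine box `Π[0, n·M_μ) ⊂ ℤ^{d+1}` (`n = L^k = η^{-1}` points per unit length)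
  with [B4]'s weights the scalar operator IS `B4BoxCov237.boxOpR n a m² M` (`scalarOp_box`), so
  `G_k(□, A₀) = (boxOpR)^{-1}(x,x')·(orthogonal transporter)` (`b4Green_constBond_box_apply`), and THEOREM (1.10) FOR
  BOXES transfers from `A = 0` (`B4Thm110ZeroBox.thm110_zero_box_roww_coeff`) to every constant configuration `A₀`
  with the same constants `δ₀, c₀` (`thm110_const_box_roww`, weighted row sums entrywise in colour;
  `thm110_const_box_value`, the printed value clause `|(G_k(□,A₀)f)_i(x)| ≤ N·c₀e^{−δ₀ dist}‖f‖_∞` componentwise);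
  non-vacuity of every binder (`N = 2` rotation flow, `d + 1 = 4`, `L = 2`, admissible contours) as closing `example`s.

## DICTIONARY (print ↦ Lean)

* Sites: a finite type `X` ([B4]: `Ω ∩ ηℤ^d`, `Ω` a union of big blocks; in §7 the box `↥(boxDom (n·M))`); colours
  `ι` (`R^N = ι → ℝ`); fields `Φ : X × ι → ℝ`, `φ(x) = fld Φ x`.  Unit-lattice block sites `Y` (`↥(boxDom M)`).
* Pairings are PLAIN sums `Ψ ⬝ᵥ Φ = Σ_{x,i}`; [B4]'s `⟨·,·⟩` carries `η^d`.  All powers of `η` are absorbed into the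
  weights exactly as in the lineage's audited dictionary `B4BoxCov237` (header): bond weight `c(x,y)` (`= η^{-2} = n²`
  per bond; in §7 split `n²/2 + n²/2` over the two orientations — for `W(y,x) = W(x,y)ᵀ`, e.g. `U(κA)` with
  antisymmetric `A`, the two oriented terms `|W(x,y)φ(y) − φ(x)|²`, `|W(y,x)φ(x) − φ(y)|²` are equal), block weight
  `q(y,x) = 1[x ∈ B(y)]` with coefficient `a·n^{-(d+1)}`, mass `m²`.
* Link variables: `W : X → X → Matrix ι ι ℝ` on ORDERED PAIRS (pairs that are not bonds have weight `0`); [B4]'s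
  `U(A_b) = e^{qeηA_b}` is `fieldLink F κ A (x,y) = F.U (κ·A(x,y))`, `κ = eη`, `F : OrthFlow ι` the one-parameter group
  `t ↦ e^{tq}` (we use only `U(0) = 1`, `U(s+t) = U(s)U(t)`, `U(t)ᵀU(t) = 1`).  Because ALL link variables lie in ONE
  one-parameter (abelian) group, a constant field `A_μ ≡ A₀,μ` has trivial holonomy and is a pure gauge
  (`fieldLink_constBond`) — this is the precise content of the print's «gauge away the constant configuration» in
  [B4]'s own setting (one generator `q`); for a non-abelian constant connection it would be false.
* Transporters `U(A(Γ_{y,x}))`: `contourTrans W emb Γ y x = transport W (emb y) (Γ y x)`, the ordered product of the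
  link variables along the site list `Γ y x` starting at the block's base point `emb y`; admissible contour systems
  END at `x` on weighted pairs (`hend`; met e.g. by direct transport, `pathEnd_direct`; [B4] p. 572 takes for
  `Γ_{y,x}` a contour in `B(y)` from `y` to `x` (paraphrase); for constant fields every such contour gives
  `U(κ⟨A₀, x − y⟩)`).
* Gauge transformations: `g : X → O(N)` (`IsGauge`), acting by `𝒢 = blockDiag g`; on vector fields
  `A^σ(u,v) = A(u,v) + σ(u) − σ(v)` (`bondGauge`; on `⟨x, x+ηe_μ⟩`: `A_μ − η∂^η_μσ`), `g(x) = U(κσ(x))`.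
* Geometry: subsets of `ηℤ^d` with integer coordinates `pos : X → ℤ^{d+1}` (NOT tori: the linear gauge `λ = −⟨A₀,·⟩`
  is not periodic, and on a torus a constant field has non-trivial holonomy).

## HONEST SCOPE

Certified: definitions (1.2)–(1.6) as finite matrices with the printed quadratic forms, exact gauge covariance, the
constant-field ⇒ zero-field reduction as operator identities, the `A = 0` Kronecker structure of p. 582, the
dictionary with `boxOpR`, and (1.10)-for-boxes at constant `A₀` (from the lineage's `A = 0` theorem).  NOT certified:
regularity (1.7), positivity (1.8), the Theorem (1.9)–(1.12) or Lemmas 2.1–2.2 for NON-constant `A` (the expansion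
`A = A₀ + A'`, (2.23)–(2.33), is not formalised), nor any statement on tori.  No internally minted statement is used as
a hypothesis: every theorem below is proved from the definitions, from Mathlib, and from the kernel theorems of
`B4BoxCov237` / `B4Thm110ZeroBox`.

Cell unit `b2b-balaban-b04` gen 13 (journal claim G-B4-GAUGE-COVARIANCE).  Value = kernel-checked definitions and
algebra of [B4] §1 at `A ≠ 0` plus the printed gauge reductions; NOT summit progress.  v1.1 = DOCFIX after the
cross-lineage read (pv22-g14): three «»-condensations (vector fields p. 572, `A(Γ)` orientation clause, the contours
`Γ_{y,x}`) reworded as marked paraphrases / verbatim clause; no declaration changed.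
-/

namespace Literature.MathematicalPhysics.QuantumFieldTheory.Balaban1983to89.B4GaugeCovariance

open Matrix Finset Kronecker

section BlockCalculus

variable {X Y Z ι : Type*}

/-! ## §1 Block operators: `ℝ^N`-valued fields on finite site sets, block kernels, block-diagonal gauge matrices -/

/-- an operator from `ℝ^ι`-valued fields on the finite site set `X` to `ℝ^ι`-valued fields on `Y`, given by its
`ι × ι` BLOCK KERNEL `K y x`: the real matrix with entries `((y,i),(x,j)) ↦ (K y x)_{ij}`. [folklore] -/
def blockOp (K : Y → X → Matrix ι ι ℝ) : Matrix (Y × ι) (X × ι) ℝ :=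
  Matrix.of fun p q => K p.1 q.1 p.2 q.2

/-- entries of a block operator. [folklore] -/
@[simp] theorem blockOp_apply (K : Y → X → Matrix ι ι ℝ) (p : Y × ι) (q : X × ι) :
    blockOp K p q = K p.1 q.1 p.2 q.2 := rfl

/-- a colour component of `GΦ` is the sum over colours `j` of the scalar kernels `G((·,i),(·,j))` applied to the
components `Φ(·,j)`. [folklore] -/
theorem mulVec_apply_colour [Fintype X] [Fintype ι] (G : Matrix (X × ι) (X × ι) ℝ) (Φ : X × ι → ℝ) (x : X)
    (i : ι) : (G *ᵥ Φ) (x, i) = ∑ j, ((Matrix.of fun z z' => G (z, i) (z', j)) *ᵥ fun z' => Φ (z', j)) x := by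
  simp only [Matrix.mulVec, dotProduct, Matrix.of_apply, Fintype.sum_prod_type]
  exact Finset.sum_comm

/-- BLOCK MULTIPLICATION: the kernel of a product is the block-convolution of the kernels. [folklore] -/
theorem blockOp_mul [Fintype Y] [Fintype ι] (K : Z → Y → Matrix ι ι ℝ) (K' : Y → X → Matrix ι ι ℝ) :
    blockOp K * blockOp K' = blockOp fun z x => ∑ y, K z y * K' y x := by
  ext ⟨z, i⟩ ⟨x, j⟩
  simp only [Matrix.mul_apply, blockOp_apply, Fintype.sum_prod_type, Matrix.sum_apply]

/-- the transpose of a block operator has the transposed, swapped kernel. [folklore] -/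
theorem blockOp_transpose (K : Y → X → Matrix ι ι ℝ) :
    (blockOp K)ᵀ = blockOp fun x y => (K y x)ᵀ := by
  ext ⟨x, i⟩ ⟨y, j⟩
  rfl

/-- `blockOp` is additive. [folklore] -/
theorem blockOp_add (K K' : Y → X → Matrix ι ι ℝ) : blockOp (K + K') = blockOp K + blockOp K' := by
  ext ⟨y, i⟩ ⟨x, j⟩
  rfl

/-- `blockOp` commutes with subtraction. [folklore] -/
theorem blockOp_sub (K K' : Y → X → Matrix ι ι ℝ) : blockOp (K - K') = blockOp K - blockOp K' := by
  ext ⟨y, i⟩ ⟨x, j⟩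
  rfl

/-- `blockOp` is homogeneous. [folklore] -/
theorem blockOp_smul (r : ℝ) (K : Y → X → Matrix ι ι ℝ) : blockOp (r • K) = r • blockOp K := by
  ext ⟨y, i⟩ ⟨x, j⟩
  rfl

/-- `blockOp` of the zero kernel. [folklore] -/
theorem blockOp_zero : blockOp (0 : Y → X → Matrix ι ι ℝ) = 0 := by
  ext ⟨y, i⟩ ⟨x, j⟩
  rfl

/-- `blockOp` commutes with finite sums. [folklore] -/
theorem blockOp_sum {α : Type*} (s : Finset α) (K : α → Y → X → Matrix ι ι ℝ) :
    blockOp (∑ a ∈ s, K a) = ∑ a ∈ s, blockOp (K a) := by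
  induction s using Finset.cons_induction with
  | empty => simp [blockOp_zero]
  | cons a s ha ih => rw [Finset.sum_cons, Finset.sum_cons, blockOp_add, ih]

/-- a block operator determines its kernel. [folklore] -/
theorem blockOp_injective :
    Function.Injective (blockOp : (Y → X → Matrix ι ι ℝ) → Matrix (Y × ι) (X × ι) ℝ) := by
  intro K K' h
  funext y x
  ext i j
  exact congrFun (congrFun h (y, i)) (x, j)

/-- the BLOCK-DIAGONAL operator with diagonal blocks `g x` (a sitewise linear map, e.g. a gauge transformation).
[folklore] -/
def blockDiag [DecidableEq X] (g : X → Matrix ι ι ℝ) : Matrix (X × ι) (X × ι) ℝ :=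
  blockOp fun x y => if x = y then g x else 0

/-- left multiplication by a block-diagonal operator acts blockwise on the left. [folklore] -/
theorem blockDiag_mul_blockOp [Fintype Y] [Fintype ι] [DecidableEq Y] (g : Y → Matrix ι ι ℝ)
    (K : Y → X → Matrix ι ι ℝ) : blockDiag g * blockOp K = blockOp fun y x => g y * K y x := by
  rw [blockDiag, blockOp_mul]
  congr 1
  funext y x
  simp [ite_mul]

/-- right multiplication by a block-diagonal operator acts blockwise on the right. [folklore] -/
theorem blockOp_mul_blockDiag [Fintype X] [Fintype ι] [DecidableEq X] (K : Y → X → Matrix ι ι ℝ)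
    (g : X → Matrix ι ι ℝ) : blockOp K * blockDiag g = blockOp fun y x => K y x * g x := by
  rw [blockDiag, blockOp_mul]
  congr 1
  funext y x
  simp [mul_ite]

/-- transpose of a block-diagonal operator. [folklore] -/
theorem blockDiag_transpose [DecidableEq X] (g : X → Matrix ι ι ℝ) :
    (blockDiag g)ᵀ = blockDiag fun x => (g x)ᵀ := by
  rw [blockDiag, blockOp_transpose, blockDiag]
  congr 1
  funext x y
  by_cases h : x = y
  · subst h; simp
  · simp [h, Ne.symm h]

/-- product of block-diagonal operators. [folklore] -/
theorem blockDiag_mul_blockDiag [Fintype X] [Fintype ι] [DecidableEq X] (g h : X → Matrix ι ι ℝ) :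
    blockDiag g * blockDiag h = blockDiag fun x => g x * h x := by
  rw [blockDiag, blockDiag, blockDiag, blockOp_mul]
  congr 1
  funext x y
  by_cases hxy : x = y
  · subst hxy; simp [ite_mul]
  · simp [ite_mul, hxy]

/-- the block-diagonal operator with identity blocks is the identity. [folklore] -/
theorem blockDiag_one [DecidableEq X] [DecidableEq ι] : blockDiag (fun _ : X => (1 : Matrix ι ι ℝ)) = 1 := by
  ext ⟨x, i⟩ ⟨y, j⟩
  simp only [blockDiag, blockOp_apply, Matrix.one_apply, Prod.mk.injEq]
  by_cases h : x = y
  · subst h; simp [Matrix.one_apply]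
  · simp [h]

/-- a "scalar" block kernel `S(y,x)·1_ι` is the Kronecker product `S ⊗ 1` — `N` uncoupled copies of the scalar
operator `S` ([B4] p. 582: «G_k(□,0) = G_k(□)1, 1 is identity operator on R^N»). [folklore] -/
theorem blockOp_smul_one [DecidableEq ι] (S : Matrix Y X ℝ) :
    blockOp (fun y x => S y x • (1 : Matrix ι ι ℝ)) = S ⊗ₖ (1 : Matrix ι ι ℝ) := by
  ext ⟨y, i⟩ ⟨x, j⟩
  simp [Matrix.kroneckerMap_apply, Matrix.one_apply]

/-- the value `φ(x) ∈ ℝ^ι` of an `N`-component field at a site. [folklore] -/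
def fld (Φ : X × ι → ℝ) (x : X) : ι → ℝ := fun i => Φ (x, i)

/-- entries of `fld`. [folklore] -/
@[simp] theorem fld_apply (Φ : X × ι → ℝ) (x : X) (i : ι) : fld Φ x i = Φ (x, i) := rfl

/-- a block operator acts by `(KΦ)(y) = Σ_x K(y,x) φ(x)`. [folklore] -/
theorem fld_blockOp_mulVec [Fintype X] [Fintype ι] (K : Y → X → Matrix ι ι ℝ) (Φ : X × ι → ℝ) (y : Y) :
    fld (blockOp K *ᵥ Φ) y = ∑ x, K y x *ᵥ fld Φ x := by
  funext i
  simp only [fld, Matrix.mulVec, dotProduct, Fintype.sum_prod_type, blockOp_apply, Finset.sum_apply]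

/-- a block-diagonal operator acts sitewise: `(𝒢Φ)(x) = g(x)φ(x)`. [folklore] -/
theorem fld_blockDiag_mulVec [Fintype X] [Fintype ι] [DecidableEq X] (g : X → Matrix ι ι ℝ) (Φ : X × ι → ℝ)
    (x : X) : fld (blockDiag g *ᵥ Φ) x = g x *ᵥ fld Φ x := by
  rw [blockDiag, fld_blockOp_mulVec, Finset.sum_eq_single x]
  · simp
  · intro y _ hy
    simp [Ne.symm hy]
  · intro h
    exact absurd (Finset.mem_univ x) h

/-- the pairing `⟨Ψ, KΦ⟩ = Σ_y Σ_x ⟨ψ(y), K(y,x)φ(x)⟩`. [folklore] -/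
theorem dotProduct_blockOp_mulVec [Fintype X] [Fintype Y] [Fintype ι] (K : Y → X → Matrix ι ι ℝ)
    (Ψ : Y × ι → ℝ) (Φ : X × ι → ℝ) :
    Ψ ⬝ᵥ (blockOp K *ᵥ Φ) = ∑ y, ∑ x, fld Ψ y ⬝ᵥ (K y x *ᵥ fld Φ x) := by
  have h : ∀ y, ∑ i, Ψ (y, i) * (blockOp K *ᵥ Φ) (y, i) = ∑ x, fld Ψ y ⬝ᵥ (K y x *ᵥ fld Φ x) := by
    intro y
    have h1 : ∀ i, (blockOp K *ᵥ Φ) (y, i) = ∑ x, (K y x *ᵥ fld Φ x) i := by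
      intro i
      have := congrFun (fld_blockOp_mulVec K Φ y) i
      simpa [Finset.sum_apply] using this
    simp_rw [h1, Finset.mul_sum]
    rw [Finset.sum_comm]
    rfl
  rw [dotProduct, Fintype.sum_prod_type]
  exact Finset.sum_congr rfl fun y _ => h y

end BlockCalculus

section Gauge

variable {X Y ι : Type*}

/-! ## §2 Gauge transformations -/

/-- a (lattice) GAUGE TRANSFORMATION on the site set `X`: an orthogonal `N × N` matrix at every site
(`(g x)ᵀ g x = 1`; in [B4] `g(x) = U(λ(x)) = exp(qeλ(x))`, §5). [folklore] -/
def IsGauge [Fintype ι] [DecidableEq ι] (g : X → Matrix ι ι ℝ) : Prop := ∀ x, (g x)ᵀ * g x = 1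

/-- orthogonal matrices are two-sided inverses of their transposes. [folklore] -/
theorem IsGauge.mul_transpose [Fintype ι] [DecidableEq ι] {g : X → Matrix ι ι ℝ} (hg : IsGauge g) (x : X) :
    g x * (g x)ᵀ = 1 :=
  mul_eq_one_comm.1 (hg x)

/-- the identity gauge transformation. [folklore] -/
theorem isGauge_one [Fintype ι] [DecidableEq ι] : IsGauge (fun _ : X => (1 : Matrix ι ι ℝ)) :=
  fun _ => by simp

/-- the GAUGE ACTION on a two-point kernel (link variables `W x y`, transporters `T y x`, block kernels):
`K y x ↦ h(y) K(y,x) g(x)ᵀ`, with `h` the transformation on the range sites and `g` on the domain sites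
([B4]: `U(A_b) ↦ U(λ(b₋))U(A_b)U(λ(b₊))^{-1}`, `U(A(Γ_{y,x})) ↦ U(λ(y))U(A(Γ_{y,x}))U(λ(x))^{-1}`). [folklore] -/
def gaugeKer [Fintype ι] (h : Y → Matrix ι ι ℝ) (g : X → Matrix ι ι ℝ) (K : Y → X → Matrix ι ι ℝ) :
    Y → X → Matrix ι ι ℝ :=
  fun y x => h y * K y x * (g x)ᵀ

/-- entries of the gauge action. [folklore] -/
@[simp] theorem gaugeKer_apply [Fintype ι] (h : Y → Matrix ι ι ℝ) (g : X → Matrix ι ι ℝ) (K : Y → X → Matrix ι ι ℝ)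
    (y : Y) (x : X) : gaugeKer h g K y x = h y * K y x * (g x)ᵀ := rfl

/-- THE GAUGE ACTION IS CONJUGATION BY BLOCK-DIAGONAL OPERATORS: `blockOp (h·K·gᵀ) = 𝒢_h · blockOp K · 𝒢_gᵀ`.
[folklore] -/
theorem blockOp_gaugeKer [Fintype X] [Fintype Y] [Fintype ι] [DecidableEq X] [DecidableEq Y]
    (h : Y → Matrix ι ι ℝ) (g : X → Matrix ι ι ℝ) (K : Y → X → Matrix ι ι ℝ) :
    blockOp (gaugeKer h g K) = blockDiag h * blockOp K * (blockDiag g)ᵀ := by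
  rw [blockDiag_mul_blockOp, blockDiag_transpose, blockOp_mul_blockDiag]
  rfl

/-- the block-diagonal operator of a gauge transformation is orthogonal: `𝒢ᵀ𝒢 = 1`. [folklore] -/
theorem blockDiag_transpose_mul_self [Fintype X] [Fintype ι] [DecidableEq X] [DecidableEq ι]
    {g : X → Matrix ι ι ℝ} (hg : IsGauge g) : (blockDiag g)ᵀ * blockDiag g = 1 := by
  rw [blockDiag_transpose, blockDiag_mul_blockDiag]
  have : (fun x => (g x)ᵀ * g x) = fun _ => (1 : Matrix ι ι ℝ) := funext hg
  rw [this, blockDiag_one]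

/-- … and `𝒢𝒢ᵀ = 1`. [folklore] -/
theorem blockDiag_mul_transpose_self [Fintype X] [Fintype ι] [DecidableEq X] [DecidableEq ι]
    {g : X → Matrix ι ι ℝ} (hg : IsGauge g) : blockDiag g * (blockDiag g)ᵀ = 1 := by
  rw [blockDiag_transpose, blockDiag_mul_blockDiag]
  have : (fun x => g x * (g x)ᵀ) = fun _ => (1 : Matrix ι ι ℝ) := funext hg.mul_transpose
  rw [this, blockDiag_one]

/-- the inverse of the block-diagonal gauge operator is its transpose. [folklore] -/
theorem blockDiag_inv [Fintype X] [Fintype ι] [DecidableEq X] [DecidableEq ι] {g : X → Matrix ι ι ℝ}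
    (hg : IsGauge g) : (blockDiag g)⁻¹ = (blockDiag g)ᵀ :=
  Matrix.inv_eq_left_inv (blockDiag_transpose_mul_self hg)

/-- the inverse of the transposed gauge operator. [folklore] -/
theorem blockDiag_transpose_inv [Fintype X] [Fintype ι] [DecidableEq X] [DecidableEq ι]
    {g : X → Matrix ι ι ℝ} (hg : IsGauge g) : ((blockDiag g)ᵀ)⁻¹ = blockDiag g :=
  Matrix.inv_eq_left_inv (blockDiag_mul_transpose_self hg)

/-- INVERSES OF GAUGE CONJUGATES: `(𝒢 H 𝒢ᵀ)⁻¹ = 𝒢 H⁻¹ 𝒢ᵀ` (Mathlib's nonsingular inverse on both sides, no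
invertibility hypothesis on `H`). [folklore] -/
theorem conj_inv [Fintype X] [Fintype ι] [DecidableEq X] [DecidableEq ι] {g : X → Matrix ι ι ℝ}
    (hg : IsGauge g) (H : Matrix (X × ι) (X × ι) ℝ) :
    (blockDiag g * H * (blockDiag g)ᵀ)⁻¹ = blockDiag g * H⁻¹ * (blockDiag g)ᵀ := by
  rw [Matrix.mul_inv_rev, Matrix.mul_inv_rev, blockDiag_inv hg, blockDiag_transpose_inv hg, Matrix.mul_assoc]

/-- a gauge transformation preserves the sitewise Euclidean norms: `|g(x)v|² = |v|²`. [folklore] -/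
theorem IsGauge.dotProduct_mulVec_self [Fintype ι] [DecidableEq ι] {g : X → Matrix ι ι ℝ} (hg : IsGauge g)
    (x : X) (v : ι → ℝ) : (g x *ᵥ v) ⬝ᵥ (g x *ᵥ v) = v ⬝ᵥ v := by
  have h1 : (g x *ᵥ v) ⬝ᵥ (g x *ᵥ v) = v ⬝ᵥ (((g x)ᵀ * g x) *ᵥ v) := by
    rw [← Matrix.mulVec_mulVec, Matrix.dotProduct_mulVec v (g x)ᵀ, Matrix.vecMul_transpose]
  rw [h1, hg x, Matrix.one_mulVec]

/-- … hence the sitewise norms of a gauge-transformed field: `|(𝒢Φ)(x)|² = |φ(x)|²`. [folklore] -/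
theorem IsGauge.fld_dotProduct_self [Fintype X] [Fintype ι] [DecidableEq X] [DecidableEq ι]
    {g : X → Matrix ι ι ℝ} (hg : IsGauge g) (Φ : X × ι → ℝ) (x : X) :
    fld (blockDiag g *ᵥ Φ) x ⬝ᵥ fld (blockDiag g *ᵥ Φ) x = fld Φ x ⬝ᵥ fld Φ x := by
  rw [fld_blockDiag_mulVec, hg.dotProduct_mulVec_self]

/-! ## §3 The covariant operators of [B4] (1.3)–(1.6) over arbitrary link variables -/

/-- the COVARIANT BOND DIFFERENCE of the ordered pair `(x, y)` with link variable `W x y` (the parallel transporter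
from `y` to `x`): the one-site-valued operator `Φ ↦ W(x,y)φ(y) − φ(x)` — [B4] (1.3) `U(A_b)φ(b₊) − φ(b₋)` for the
bond `b = ⟨x, y⟩` (the factor `η^{-1}` is carried by the bond weight, DICTIONARY). [cite: Balaban1983RegularityDecay,
p. 572 (1.3)] -/
def bondDiff [DecidableEq X] [DecidableEq ι] (W : X → X → Matrix ι ι ℝ) (x y : X) :
    Matrix (Unit × ι) (X × ι) ℝ :=
  blockOp fun _ z => (if z = y then W x y else 0) - (if z = x then 1 else 0)

/-- the covariant bond difference evaluates to `W(x,y)φ(y) − φ(x)`. [cite: Balaban1983RegularityDecay, p. 572 (1.3)] -/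
theorem fld_bondDiff_mulVec [Fintype X] [Fintype ι] [DecidableEq X] [DecidableEq ι] (W : X → X → Matrix ι ι ℝ)
    (x y : X)
    (Φ : X × ι → ℝ) (u : Unit) : fld (bondDiff W x y *ᵥ Φ) u = W x y *ᵥ fld Φ y - fld Φ x := by
  rw [bondDiff, fld_blockOp_mulVec]
  simp only [Matrix.sub_mulVec, Finset.sum_sub_distrib]
  rw [Finset.sum_eq_single y, Finset.sum_eq_single x]
  · simp
  · intro z _ hz; simp [hz]
  · intro h; exact absurd (Finset.mem_univ x) h
  · intro z _ hz; simp [hz]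
  · intro h; exact absurd (Finset.mem_univ y) h

/-- THE COVARIANT LAPLACIAN `−Δ_W` with bond weights `c(x,y)` (on ORDERED pairs; [B4]: `c = η^{-2}` on the positively
oriented nearest-neighbour bonds `⟨x, x + ηe_μ⟩` inside `Ω`, `0` otherwise — Neumann conditions) and link variables
`W`: the operator `Σ_{x,y} c(x,y)·D_{xy}ᵀD_{xy}` of the quadratic form (1.3) (`covLap_form`).
[cite: Balaban1983RegularityDecay, p. 572 (1.3)] -/
def covLap [Fintype X] [Fintype ι] [DecidableEq X] [DecidableEq ι] (c : X → X → ℝ) (W : X → X → Matrix ι ι ℝ) :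
    Matrix (X × ι) (X × ι) ℝ :=
  ∑ x, ∑ y, c x y • ((bondDiff W x y)ᵀ * bondDiff W x y)

/-- **(1.3) AS PRINTED**: `⟨Φ, (−Δ_W)Φ⟩ = Σ_{x,y} c(x,y)·|W(x,y)φ(y) − φ(x)|²`.
[cite: Balaban1983RegularityDecay, p. 572 (1.3)] -/
theorem covLap_form [Fintype X] [Fintype ι] [DecidableEq X] [DecidableEq ι] (c : X → X → ℝ)
    (W : X → X → Matrix ι ι ℝ)
    (Φ : X × ι → ℝ) :
    Φ ⬝ᵥ (covLap c W *ᵥ Φ)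
      = ∑ x, ∑ y, c x y * ((W x y *ᵥ fld Φ y - fld Φ x) ⬝ᵥ (W x y *ᵥ fld Φ y - fld Φ x)) := by
  have hterm : ∀ x y, Φ ⬝ᵥ ((c x y • ((bondDiff W x y)ᵀ * bondDiff W x y)) *ᵥ Φ)
      = c x y * ((W x y *ᵥ fld Φ y - fld Φ x) ⬝ᵥ (W x y *ᵥ fld Φ y - fld Φ x)) := by
    intro x y
    rw [Matrix.smul_mulVec, dotProduct_smul, smul_eq_mul, ← Matrix.mulVec_mulVec,
      Matrix.dotProduct_mulVec, Matrix.vecMul_transpose]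
    congr 1
    rw [dotProduct, Fintype.sum_prod_type, Finset.sum_eq_single ()]
    · have h := fld_bondDiff_mulVec W x y Φ ()
      have h' : ∀ i, (bondDiff W x y *ᵥ Φ) ((), i) = (W x y *ᵥ fld Φ y - fld Φ x) i := fun i => congrFun h i
      simp_rw [h']
      rfl
    · intro u _ hu; exact absurd (Subsingleton.elim u ()) hu
    · intro h; exact absurd (Finset.mem_univ ()) h
  simp only [covLap, Matrix.sum_mulVec, dotProduct_sum, hterm]

/-- THE AVERAGING OPERATOR (1.4) with block weights `q(y,x)` ([B4]: `q = η^d·1[x ∈ B^k(y)]`) and transporters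
`T(y,x)` ([B4]: `U(A(Γ^{(k)}_{y,x}))`, the parallel transport along the contour `Γ_{y,x}`, §4): `(QΦ)(y) =
Σ_x q(y,x) T(y,x) φ(x)` (`fld_avgOp_mulVec`). [cite: Balaban1983RegularityDecay, p. 572 (1.4)] -/
def avgOp (q : Y → X → ℝ) (T : Y → X → Matrix ι ι ℝ) : Matrix (Y × ι) (X × ι) ℝ :=
  blockOp fun y x => q y x • T y x

/-- **(1.4) AS PRINTED**: `(Q_k(A)φ)(y) = Σ_{x} q(y,x)·U(A(Γ_{y,x}))φ(x)`. [cite: Balaban1983RegularityDecay, p. 572 (1.4)] -/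
theorem fld_avgOp_mulVec [Fintype X] [Fintype ι] (q : Y → X → ℝ) (T : Y → X → Matrix ι ι ℝ) (Φ : X × ι → ℝ)
    (y : Y) : fld (avgOp q T *ᵥ Φ) y = ∑ x, q y x • (T y x *ᵥ fld Φ x) := by
  rw [avgOp, fld_blockOp_mulVec]
  simp [Matrix.smul_mulVec]

/-- THE OPERATOR `P_k = Q_k^* Q_k` OF (1.5) (adjoint for the counting pairings; the `η^d`-weights of the printed
`L²` pairings are absorbed into `q` and the coefficient `a`, DICTIONARY). [cite: Balaban1983RegularityDecay, p. 572 (1.5)] -/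
def projOp [Fintype Y] [Fintype ι] (q : Y → X → ℝ) (T : Y → X → Matrix ι ι ℝ) : Matrix (X × ι) (X × ι) ℝ :=
  (avgOp q T)ᵀ * avgOp q T

/-- the quadratic form of `P_k`: `⟨Φ, PΦ⟩ = |QΦ|²`. [cite: Balaban1983RegularityDecay, p. 572 (1.5)] -/
theorem projOp_form [Fintype X] [Fintype Y] [Fintype ι] (q : Y → X → ℝ) (T : Y → X → Matrix ι ι ℝ)
    (Φ : X × ι → ℝ) : Φ ⬝ᵥ (projOp q T *ᵥ Φ) = (avgOp q T *ᵥ Φ) ⬝ᵥ (avgOp q T *ᵥ Φ) := by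
  rw [projOp, ← Matrix.mulVec_mulVec, Matrix.dotProduct_mulVec, Matrix.vecMul_transpose]

/-- THE OPERATOR OF (1.6): `H = −Δ_W + m² + a·P_k` (its inverse is the Green's function `G_k(Ω, A)`).
[cite: Balaban1983RegularityDecay, p. 572 (1.6)] -/
def covOp [Fintype X] [Fintype Y] [Fintype ι] [DecidableEq X] [DecidableEq ι] (c : X → X → ℝ) (m2 a : ℝ)
    (q : Y → X → ℝ) (W : X → X → Matrix ι ι ℝ) (T : Y → X → Matrix ι ι ℝ) : Matrix (X × ι) (X × ι) ℝ :=
  covLap c W + m2 • (1 : Matrix (X × ι) (X × ι) ℝ) + a • projOp q T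

/-- THE GREEN'S FUNCTION (1.6): `G_k(Ω, A) = (−Δ_W + m² + aP_k)^{-1}` (Mathlib's nonsingular inverse: the inverse
whenever `H` is invertible, e.g. under the positivity (1.8)). [cite: Balaban1983RegularityDecay, p. 572 (1.6)] -/
noncomputable def green [Fintype X] [Fintype Y] [Fintype ι] [DecidableEq X] [DecidableEq ι] (c : X → X → ℝ)
    (m2 a : ℝ)
    (q : Y → X → ℝ) (W : X → X → Matrix ι ι ℝ) (T : Y → X → Matrix ι ι ℝ) : Matrix (X × ι) (X × ι) ℝ :=
  (covOp c m2 a q W T)⁻¹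

/-! ### Gauge covariance -/

/-- the covariant bond difference is GAUGE COVARIANT: `D_{xy}(gWgᵀ) = g(x)·D_{xy}(W)·𝒢ᵀ`. [folklore] -/
theorem bondDiff_gauge [Fintype X] [Fintype ι] [DecidableEq X] [DecidableEq ι] {g : X → Matrix ι ι ℝ}
    (hg : IsGauge g) (W : X → X → Matrix ι ι ℝ) (x y : X) :
    bondDiff (gaugeKer g g W) x y = blockDiag (fun _ : Unit => g x) * bondDiff W x y * (blockDiag g)ᵀ := by
  rw [bondDiff, bondDiff, ← blockOp_gaugeKer]
  congr 1
  funext u z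
  simp only [gaugeKer_apply, Matrix.mul_sub, Matrix.sub_mul]
  congr 1
  · by_cases hz : z = y
    · subst hz; simp [Matrix.mul_assoc]
    · simp [hz]
  · by_cases hz : z = x
    · subst hz; simp [hg.mul_transpose]
    · simp [hz]

/-- **GAUGE COVARIANCE OF THE COVARIANT LAPLACIAN**: `−Δ_{gWgᵀ} = 𝒢(−Δ_W)𝒢ᵀ`. [folklore] -/
theorem covLap_gauge [Fintype X] [Fintype ι] [DecidableEq X] [DecidableEq ι] {g : X → Matrix ι ι ℝ}
    (hg : IsGauge g) (c : X → X → ℝ) (W : X → X → Matrix ι ι ℝ) :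
    covLap c (gaugeKer g g W) = blockDiag g * covLap c W * (blockDiag g)ᵀ := by
  have hterm : ∀ x y, (bondDiff (gaugeKer g g W) x y)ᵀ * bondDiff (gaugeKer g g W) x y
      = blockDiag g * ((bondDiff W x y)ᵀ * bondDiff W x y) * (blockDiag g)ᵀ := by
    intro x y
    have h1 : (blockDiag fun _ : Unit => g x)ᵀ * blockDiag (fun _ : Unit => g x) = 1 :=
      blockDiag_transpose_mul_self fun _ => hg x
    rw [bondDiff_gauge hg, Matrix.transpose_mul, Matrix.transpose_mul, Matrix.transpose_transpose]
    simp only [Matrix.mul_assoc]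
    rw [← Matrix.mul_assoc (blockDiag fun _ : Unit => g x)ᵀ (blockDiag fun _ : Unit => g x), h1,
      Matrix.one_mul]
  simp only [covLap, hterm, Finset.mul_sum, Finset.sum_mul, Matrix.mul_smul, Matrix.smul_mul]

/-- **GAUGE COVARIANCE OF THE AVERAGING OPERATOR (1.4)**: `Q(hTgᵀ) = ℋ·Q(T)·𝒢ᵀ` (no orthogonality needed). [folklore] -/
theorem avgOp_gauge [Fintype X] [Fintype Y] [Fintype ι] [DecidableEq X] [DecidableEq Y]
    (h : Y → Matrix ι ι ℝ) (g : X → Matrix ι ι ℝ) (q : Y → X → ℝ) (T : Y → X → Matrix ι ι ℝ) :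
    avgOp q (gaugeKer h g T) = blockDiag h * avgOp q T * (blockDiag g)ᵀ := by
  rw [avgOp, avgOp, ← blockOp_gaugeKer]
  congr 1
  funext y x
  simp [Matrix.mul_smul, Matrix.smul_mul]

/-- **GAUGE COVARIANCE OF `P_k` (1.5)**: `P(hTgᵀ) = 𝒢·P(T)·𝒢ᵀ` for orthogonal `h`. [folklore] -/
theorem projOp_gauge [Fintype X] [Fintype Y] [Fintype ι] [DecidableEq X] [DecidableEq Y] [DecidableEq ι]
    {h : Y → Matrix ι ι ℝ} (hh : IsGauge h) (g : X → Matrix ι ι ℝ) (q : Y → X → ℝ)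
    (T : Y → X → Matrix ι ι ℝ) : projOp q (gaugeKer h g T) = blockDiag g * projOp q T * (blockDiag g)ᵀ := by
  rw [projOp, projOp, avgOp_gauge, Matrix.transpose_mul, Matrix.transpose_mul, Matrix.transpose_transpose]
  simp only [Matrix.mul_assoc]
  rw [← Matrix.mul_assoc (blockDiag h)ᵀ (blockDiag h), blockDiag_transpose_mul_self hh, Matrix.one_mul]

/-- **GAUGE COVARIANCE OF THE OPERATOR (1.6)**: `H(gWgᵀ, hTgᵀ) = 𝒢·H(W,T)·𝒢ᵀ`. [folklore] -/
theorem covOp_gauge [Fintype X] [Fintype Y] [Fintype ι] [DecidableEq X] [DecidableEq Y] [DecidableEq ι]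
    {g : X → Matrix ι ι ℝ} (hg : IsGauge g) {h : Y → Matrix ι ι ℝ} (hh : IsGauge h) (c : X → X → ℝ)
    (m2 a : ℝ) (q : Y → X → ℝ) (W : X → X → Matrix ι ι ℝ) (T : Y → X → Matrix ι ι ℝ) :
    covOp c m2 a q (gaugeKer g g W) (gaugeKer h g T) = blockDiag g * covOp c m2 a q W T * (blockDiag g)ᵀ := by
  rw [covOp, covOp, covLap_gauge hg, projOp_gauge hh, Matrix.mul_add, Matrix.mul_add, Matrix.add_mul,
    Matrix.add_mul, Matrix.mul_smul, Matrix.smul_mul, Matrix.mul_one, blockDiag_mul_transpose_self hg,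
    Matrix.mul_smul, Matrix.smul_mul]

/-- **GAUGE COVARIANCE OF THE GREEN'S FUNCTION (1.6)**: `G(gWgᵀ, hTgᵀ) = 𝒢·G(W,T)·𝒢ᵀ` — the content of
«we reduce them to the case A₀ = 0 [by] the gauge transformation» ([B4] p. 580) at the level of kernels. [folklore] -/
theorem green_gauge [Fintype X] [Fintype Y] [Fintype ι] [DecidableEq X] [DecidableEq Y] [DecidableEq ι]
    {g : X → Matrix ι ι ℝ} (hg : IsGauge g) {h : Y → Matrix ι ι ℝ} (hh : IsGauge h) (c : X → X → ℝ)
    (m2 a : ℝ) (q : Y → X → ℝ) (W : X → X → Matrix ι ι ℝ) (T : Y → X → Matrix ι ι ℝ) :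
    green c m2 a q (gaugeKer g g W) (gaugeKer h g T) = blockDiag g * green c m2 a q W T * (blockDiag g)ᵀ := by
  rw [green, green, covOp_gauge hg hh, conj_inv hg]

/-- the Green's function intertwines the gauge transformation of fields: `G' (𝒢Φ) = 𝒢 (G Φ)`. [folklore] -/
theorem green_mulVec_gauge [Fintype X] [Fintype Y] [Fintype ι] [DecidableEq X] [DecidableEq Y] [DecidableEq ι]
    {g : X → Matrix ι ι ℝ} (hg : IsGauge g) {h : Y → Matrix ι ι ℝ} (hh : IsGauge h) (c : X → X → ℝ)
    (m2 a : ℝ) (q : Y → X → ℝ) (W : X → X → Matrix ι ι ℝ) (T : Y → X → Matrix ι ι ℝ) (Φ : X × ι → ℝ) :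
    green c m2 a q (gaugeKer g g W) (gaugeKer h g T) *ᵥ (blockDiag g *ᵥ Φ)
      = blockDiag g *ᵥ (green c m2 a q W T *ᵥ Φ) := by
  rw [green_gauge hg hh, Matrix.mulVec_mulVec, Matrix.mul_assoc, Matrix.mul_assoc,
    blockDiag_transpose_mul_self hg, Matrix.mul_one, Matrix.mulVec_mulVec]

/-! ## §4 Parallel transport along contours ([B4] p. 572: `A(Γ) = Σ_{b ⊂ Γ} A_b`, `U(A(Γ_{y,x}))`) -/

/-- the END POINT of the lattice contour that starts at `x` and visits the listed sites in order. [folklore] -/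
def pathEnd : X → List X → X
  | x, [] => x
  | _, y :: l => pathEnd y l

/-- PARALLEL TRANSPORT along a contour: the ordered product of the link variables of its steps,
`W(x₀,x₁)W(x₁,x₂)⋯W(x_{n−1},x_n)` (for [B4]'s commuting `U(A_b) = exp(qeηA_b)` this is `U(A(Γ)) = exp(qeηΣ_bA_b)`,
§5). [cite: Balaban1983RegularityDecay, p. 572 (1.4)] -/
def transport (W : X → X → Matrix ι ι ℝ) [Fintype ι] [DecidableEq ι] : X → List X → Matrix ι ι ℝ
  | _, [] => 1
  | x, y :: l => W x y * transport W y l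

/-- **GAUGE COVARIANCE OF PARALLEL TRANSPORT** (telescoping): `U'(Γ) = g(start)·U(Γ)·g(end)ᵀ`. [folklore] -/
theorem transport_gauge [Fintype ι] [DecidableEq ι] {g : X → Matrix ι ι ℝ} (hg : IsGauge g)
    (W : X → X → Matrix ι ι ℝ) (x : X) (l : List X) :
    transport (gaugeKer g g W) x l = g x * transport W x l * (g (pathEnd x l))ᵀ := by
  induction l generalizing x with
  | nil => simp [transport, pathEnd, hg.mul_transpose]
  | cons y l ih =>
      simp only [transport, pathEnd, ih, gaugeKer_apply]
      simp only [Matrix.mul_assoc]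
      rw [← Matrix.mul_assoc (g y)ᵀ (g y), hg y, Matrix.one_mul]

/-- transport of the trivial link field is trivial. [folklore] -/
theorem transport_one [Fintype ι] [DecidableEq ι] (x : X) (l : List X) :
    transport (fun _ _ : X => (1 : Matrix ι ι ℝ)) x l = 1 := by
  induction l generalizing x with
  | nil => rfl
  | cons y l ih => simp [transport, ih]

/-- the TRANSPORTERS OF A CONTOUR SYSTEM: `T(y,x) = U(A(Γ_{y,x}))`, the transport along the chosen contour
`Γ_{y,x}` from the block site `emb y` ([B4]: `y ∈ ℤ^d ⊂ ηℤ^d`) towards `x`. [cite: Balaban1983RegularityDecay, p. 572 (1.4)] -/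
def contourTrans [Fintype ι] [DecidableEq ι] (W : X → X → Matrix ι ι ℝ) (emb : Y → X) (Γ : Y → X → List X) :
    Y → X → Matrix ι ι ℝ :=
  fun y x => transport W (emb y) (Γ y x)

/-- averaging operators with the same weights and transporters agreeing where the weights are non-zero coincide.
[folklore] -/
theorem avgOp_congr {q : Y → X → ℝ} {T T' : Y → X → Matrix ι ι ℝ} (hT : ∀ y x, q y x ≠ 0 → T y x = T' y x) :
    avgOp q T = avgOp q T' := by
  unfold avgOp
  congr 1
  funext y x
  by_cases hq : q y x = 0
  · simp [hq]
  · rw [hT y x hq]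

/-- **GAUGE COVARIANCE OF THE CONTOUR TRANSPORTERS**: if every contour `Γ_{y,x}` carrying weight ends at `x`, then
gauging the link variables gauges the averaging operator: `Q(gWgᵀ-transport) = Q((g∘emb)·T·gᵀ)`. [folklore] -/
theorem avgOp_contourTrans_gauge [Fintype ι] [DecidableEq ι] {g : X → Matrix ι ι ℝ} (hg : IsGauge g)
    (W : X → X → Matrix ι ι ℝ) {q : Y → X → ℝ} {emb : Y → X} {Γ : Y → X → List X}
    (hend : ∀ y x, q y x ≠ 0 → pathEnd (emb y) (Γ y x) = x) :
    avgOp q (contourTrans (gaugeKer g g W) emb Γ) = avgOp q (gaugeKer (g ∘ emb) g (contourTrans W emb Γ)) :=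
  avgOp_congr fun y x hq => by
    simp only [contourTrans, transport_gauge hg, hend y x hq, gaugeKer_apply, Function.comp_apply]

/-- a gauge transformation restricted along `emb` is a gauge transformation. [folklore] -/
theorem IsGauge.comp [Fintype ι] [DecidableEq ι] {g : X → Matrix ι ι ℝ} (hg : IsGauge g) (emb : Y → X) :
    IsGauge (g ∘ emb) :=
  fun y => hg (emb y)

/-- **GAUGE COVARIANCE OF [B4]'s `H = −Δ_A + m² + aQ_k^*(A)Q_k(A)` WITH CONTOUR TRANSPORTERS**: gauging the link
variables conjugates the operator, `H(gWgᵀ) = 𝒢H(W)𝒢ᵀ`. [folklore] -/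
theorem covOp_contour_gauge [Fintype X] [Fintype Y] [Fintype ι] [DecidableEq X] [DecidableEq Y] [DecidableEq ι]
    {g : X → Matrix ι ι ℝ} (hg : IsGauge g) (c : X → X → ℝ) (m2 a : ℝ) {q : Y → X → ℝ} {emb : Y → X}
    {Γ : Y → X → List X} (hend : ∀ y x, q y x ≠ 0 → pathEnd (emb y) (Γ y x) = x)
    (W : X → X → Matrix ι ι ℝ) :
    covOp c m2 a q (gaugeKer g g W) (contourTrans (gaugeKer g g W) emb Γ)
      = blockDiag g * covOp c m2 a q W (contourTrans W emb Γ) * (blockDiag g)ᵀ := by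
  have hQ := avgOp_contourTrans_gauge hg W hend (q := q)
  have hP : projOp q (contourTrans (gaugeKer g g W) emb Γ)
      = projOp q (gaugeKer (g ∘ emb) g (contourTrans W emb Γ)) := by rw [projOp, projOp, hQ]
  rw [covOp, hP, ← covOp, covOp_gauge hg (hg.comp emb)]

/-- **… AND THE GREEN'S FUNCTION**: `G(gWgᵀ) = 𝒢G(W)𝒢ᵀ`. [folklore] -/
theorem green_contour_gauge [Fintype X] [Fintype Y] [Fintype ι] [DecidableEq X] [DecidableEq Y] [DecidableEq ι]
    {g : X → Matrix ι ι ℝ} (hg : IsGauge g) (c : X → X → ℝ) (m2 a : ℝ) {q : Y → X → ℝ} {emb : Y → X}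
    {Γ : Y → X → List X} (hend : ∀ y x, q y x ≠ 0 → pathEnd (emb y) (Γ y x) = x)
    (W : X → X → Matrix ι ι ℝ) :
    green c m2 a q (gaugeKer g g W) (contourTrans (gaugeKer g g W) emb Γ)
      = blockDiag g * green c m2 a q W (contourTrans W emb Γ) * (blockDiag g)ᵀ := by
  rw [green, green, covOp_contour_gauge hg c m2 a hend, conj_inv hg]

end Gauge

section Kernels

variable {X Y ι : Type*}

/-! ## §5 The block kernels: the matrix of `−Δ_W` and of `P_k`; the zero-field reduction to `N` scalar copies -/

/-- the site projection `Φ ↦ φ(x)`. [folklore] -/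
def siteP [DecidableEq X] [DecidableEq ι] (x : X) : Matrix (Unit × ι) (X × ι) ℝ :=
  blockOp fun _ z => if z = x then 1 else 0

/-- the covariant bond difference in terms of site projections: `D_{xy} = W(x,y)·π_y − π_x`. [folklore] -/
theorem bondDiff_eq [Fintype X] [Fintype ι] [DecidableEq X] [DecidableEq ι] (W : X → X → Matrix ι ι ℝ)
    (x y : X) : bondDiff W x y = blockDiag (fun _ : Unit => W x y) * siteP (ι := ι) y - siteP (ι := ι) x := by
  rw [siteP, siteP, blockDiag_mul_blockOp, bondDiff, ← blockOp_sub]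
  congr 1
  funext u z
  by_cases hz : z = y <;> simp [hz]

/-- the BLOCK MATRIX UNIT: the block `M` at position `(x, y)`, zero elsewhere. [folklore] -/
def unitOp [DecidableEq X] (x y : X) (M : Matrix ι ι ℝ) : Matrix (X × ι) (X × ι) ℝ :=
  blockOp fun z z' => if z = x ∧ z' = y then M else 0

/-- `π_xᵀ · M · π_y` is the block matrix unit with block `M` at `(x, y)`. [folklore] -/
theorem siteP_transpose_mul_siteP [Fintype X] [Fintype ι] [DecidableEq X] [DecidableEq ι] (x y : X)
    (M : Matrix ι ι ℝ) :
    (siteP (ι := ι) x)ᵀ * blockDiag (fun _ : Unit => M) * siteP (ι := ι) y = unitOp x y M := by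
  rw [siteP, siteP, blockOp_transpose, blockOp_mul_blockDiag, blockOp_mul, unitOp]
  congr 1
  funext z z'
  rw [Fintype.sum_unique]
  by_cases hz : z = x
  · by_cases hz' : z' = y
    · simp [hz, hz']
    · simp [hz, hz']
  · simp [hz]

/-- `π_xᵀ · M · (N · π_y)` is the block matrix unit with block `MN`. [folklore] -/
theorem siteP_sandwich [Fintype X] [Fintype ι] [DecidableEq X] [DecidableEq ι] (x y : X)
    (M N : Matrix ι ι ℝ) :
    (siteP (ι := ι) x)ᵀ * blockDiag (fun _ : Unit => M) * (blockDiag (fun _ : Unit => N) * siteP (ι := ι) y)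
      = unitOp x y (M * N) := by
  rw [Matrix.mul_assoc, ← Matrix.mul_assoc (blockDiag fun _ : Unit => M) (blockDiag fun _ : Unit => N),
    blockDiag_mul_blockDiag, ← Matrix.mul_assoc, siteP_transpose_mul_siteP]

/-- `π_xᵀ · π_x` is the block matrix unit with the identity block at `(x, x)`. [folklore] -/
theorem siteP_transpose_mul_self [Fintype X] [Fintype ι] [DecidableEq X] [DecidableEq ι] (x : X) :
    (siteP (ι := ι) x)ᵀ * siteP (ι := ι) x = unitOp x x (1 : Matrix ι ι ℝ) := by
  rw [← siteP_transpose_mul_siteP x x (1 : Matrix ι ι ℝ), blockDiag_one, Matrix.mul_one]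

/-- `Σ_{x,y} c(x,y)·E_{xy}[M(x,y)]` has block kernel `c(z,z')M(z,z')`. [folklore] -/
theorem sum_unitOp_xy [Fintype X] [DecidableEq X] (c : X → X → ℝ) (M : X → X → Matrix ι ι ℝ) :
    ∑ x, ∑ y, c x y • unitOp x y (M x y) = blockOp fun z z' => c z z' • M z z' := by
  simp only [unitOp, ← blockOp_smul, ← blockOp_sum]
  congr 1
  funext z z'
  simp only [Finset.sum_apply, Pi.smul_apply, smul_ite, smul_zero]
  rw [Finset.sum_eq_single z]
  · rw [Finset.sum_eq_single z']
    · simp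
    · intro y _ hy; simp [Ne.symm hy]
    · intro h; exact absurd (Finset.mem_univ z') h
  · intro x _ hx; simp [Ne.symm hx]
  · intro h; exact absurd (Finset.mem_univ z) h

/-- `Σ_{x,y} c(x,y)·E_{yx}[M(x,y)]` has block kernel `c(z',z)M(z',z)`. [folklore] -/
theorem sum_unitOp_yx [Fintype X] [DecidableEq X] (c : X → X → ℝ) (M : X → X → Matrix ι ι ℝ) :
    ∑ x, ∑ y, c x y • unitOp y x (M x y) = blockOp fun z z' => c z' z • M z' z := by
  simp only [unitOp, ← blockOp_smul, ← blockOp_sum]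
  congr 1
  funext z z'
  simp only [Finset.sum_apply, Pi.smul_apply, smul_ite, smul_zero]
  rw [Finset.sum_eq_single z']
  · rw [Finset.sum_eq_single z]
    · simp
    · intro y _ hy; simp [Ne.symm hy]
    · intro h; exact absurd (Finset.mem_univ z) h
  · intro x _ hx; simp [Ne.symm hx]
  · intro h; exact absurd (Finset.mem_univ z') h

/-- `Σ_{x,y} c(x,y)·E_{xx}[M(x,y)]` has the diagonal block kernel `1[z = z']·Σ_y c(z,y)M(z,y)`. [folklore] -/
theorem sum_unitOp_xx [Fintype X] [DecidableEq X] (c : X → X → ℝ) (M : X → X → Matrix ι ι ℝ) :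
    ∑ x, ∑ y, c x y • unitOp x x (M x y) = blockOp fun z z' => if z = z' then ∑ y, c z y • M z y else 0 := by
  simp only [unitOp, ← blockOp_smul, ← blockOp_sum]
  congr 1
  funext z z'
  simp only [Finset.sum_apply, Pi.smul_apply, smul_ite, smul_zero]
  rw [Finset.sum_eq_single z]
  · by_cases h : z = z'
    · subst h; simp
    · simp [h, Ne.symm h]
  · intro x _ hx; simp [Ne.symm hx]
  · intro h; exact absurd (Finset.mem_univ z) h

/-- `Σ_{x,y} c(x,y)·E_{yy}[M(x,y)]` has the diagonal block kernel `1[z = z']·Σ_x c(x,z)M(x,z)`. [folklore] -/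
theorem sum_unitOp_yy [Fintype X] [DecidableEq X] (c : X → X → ℝ) (M : X → X → Matrix ι ι ℝ) :
    ∑ x, ∑ y, c x y • unitOp y y (M x y) = blockOp fun z z' => if z = z' then ∑ x, c x z • M x z else 0 := by
  simp only [unitOp, ← blockOp_smul, ← blockOp_sum]
  congr 1
  funext z z'
  simp only [Finset.sum_apply, Pi.smul_apply, smul_ite, smul_zero]
  rw [Finset.sum_comm, Finset.sum_eq_single z]
  · by_cases h : z = z'
    · subst h; simp
    · simp [h, Ne.symm h]
  · intro x _ hx; simp [Ne.symm hx]
  · intro h; exact absurd (Finset.mem_univ z) h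

/-- the BLOCK KERNEL OF THE COVARIANT LAPLACIAN `−Δ_W`: diagonal blocks `Σ_x c(x,z)W(x,z)ᵀW(x,z) +
(Σ_y c(z,y))·1` (for orthogonal link variables `= (total bond weight at z)·1`), off-diagonal blocks the HOPPING
TERMS `−c(z',z)W(z',z)ᵀ − c(z,z')W(z,z')` ([B4]: `−η^{-2}U(A_b)` for the bond `b` joining `z, z'`). [folklore] -/
def covLapKer [Fintype X] [Fintype ι] [DecidableEq X] [DecidableEq ι] (c : X → X → ℝ)
    (W : X → X → Matrix ι ι ℝ) (z z' : X) : Matrix ι ι ℝ :=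
  ((if z = z' then ∑ x, c x z • ((W x z)ᵀ * W x z) else 0) - c z' z • (W z' z)ᵀ)
    - (c z z' • W z z' - (if z = z' then ∑ y, c z y • (1 : Matrix ι ι ℝ) else 0))

/-- **THE MATRIX OF `−Δ_W`**: `covLap c W` is the block operator with kernel `covLapKer c W`. [folklore] -/
theorem covLap_eq_blockOp [Fintype X] [Fintype ι] [DecidableEq X] [DecidableEq ι] (c : X → X → ℝ)
    (W : X → X → Matrix ι ι ℝ) : covLap c W = blockOp (covLapKer c W) := by
  have hterm : ∀ x y, (bondDiff W x y)ᵀ * bondDiff W x y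
      = (unitOp y y ((W x y)ᵀ * W x y) - unitOp y x (W x y)ᵀ) - (unitOp x y (W x y) - unitOp x x 1) := by
    intro x y
    rw [bondDiff_eq, Matrix.transpose_sub, Matrix.transpose_mul, blockDiag_transpose, Matrix.sub_mul,
      Matrix.mul_sub, Matrix.mul_sub, siteP_sandwich, siteP_transpose_mul_siteP,
      ← Matrix.mul_assoc (siteP (ι := ι) x)ᵀ, siteP_transpose_mul_siteP, siteP_transpose_mul_self]
  simp only [covLap, hterm, smul_sub, Finset.sum_sub_distrib]
  rw [sum_unitOp_yy c (fun x y => (W x y)ᵀ * W x y), sum_unitOp_yx c (fun x y => (W x y)ᵀ), sum_unitOp_xy c W,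
    sum_unitOp_xx c (fun _ _ => (1 : Matrix ι ι ℝ)), ← blockOp_sub, ← blockOp_sub, ← blockOp_sub]
  rfl

/-- the BLOCK KERNEL OF `P_k = Q_k^*Q_k`: `P(x,x') = Σ_y q(y,x)q(y,x')·T(y,x)ᵀT(y,x')` ([B4]: `η^{2d}·1[x, x' ∈ B(y)]·
U(A(Γ_{y,x}))^{-1}U(A(Γ_{y,x'}))`). [folklore] -/
theorem projOp_eq_blockOp [Fintype X] [Fintype Y] [Fintype ι] (q : Y → X → ℝ) (T : Y → X → Matrix ι ι ℝ) :
    projOp q T = blockOp fun x x' => ∑ y, (q y x * q y x') • ((T y x)ᵀ * T y x') := by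
  rw [projOp, avgOp, blockOp_transpose, blockOp_mul]
  congr 1
  funext x x'
  refine Finset.sum_congr rfl fun y _ => ?_
  rw [Matrix.transpose_smul, Matrix.smul_mul, Matrix.mul_smul, smul_smul, mul_comm]

/-- the SCALAR (one-component, `A = 0`) version of the operator (1.6) with the same weights:
`(−Δ + m² + aQ^*Q)(z,z') = 1[z=z'](Σ_x c(x,z) + Σ_y c(z,y)) − c(z',z) − c(z,z') + m²1[z=z'] + aΣ_y q(y,z)q(y,z')`
([B4] p. 582: «the one-component propagator `G_k(□)`»). [folklore] -/
def scalarOp [Fintype X] [Fintype Y] [DecidableEq X] (c : X → X → ℝ) (m2 a : ℝ) (q : Y → X → ℝ) :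
    Matrix X X ℝ :=
  Matrix.of fun z z' =>
    (((if z = z' then ∑ x, c x z else 0) - c z' z) - (c z z' - (if z = z' then ∑ y, c z y else 0)))
      + (if z = z' then m2 else 0) + a * ∑ y, q y z * q y z'

/-- **THE ZERO-FIELD OPERATOR IS `N` UNCOUPLED COPIES OF THE SCALAR ONE**: with trivial link variables and
transporters, `H = (scalar H) ⊗ 1_N` ([B4] p. 582 «G_k(□,0) = G_k(□)1, 1 is identity operator on R^N»).
[cite: Balaban1983RegularityDecay, p. 582] -/
theorem covOp_trivial [Fintype X] [Fintype Y] [Fintype ι] [DecidableEq X] [DecidableEq ι] (c : X → X → ℝ)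
    (m2 a : ℝ) (q : Y → X → ℝ) :
    covOp c m2 a q (fun _ _ => (1 : Matrix ι ι ℝ)) (fun _ _ => (1 : Matrix ι ι ℝ))
      = scalarOp c m2 a q ⊗ₖ (1 : Matrix ι ι ℝ) := by
  rw [← blockOp_smul_one, covOp, covLap_eq_blockOp, projOp_eq_blockOp, ← blockDiag_one, blockDiag,
    ← blockOp_smul, ← blockOp_smul, ← blockOp_add, ← blockOp_add]
  congr 1
  funext z z'
  simp only [covLapKer, scalarOp, Matrix.of_apply, Pi.add_apply, Pi.smul_apply, Matrix.transpose_one,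
    Matrix.mul_one, ← Finset.sum_smul]
  split_ifs <;> simp only [add_smul, sub_smul, mul_smul, smul_zero, zero_smul]

/-- the inverse of `S ⊗ 1_N` is `S^{-1} ⊗ 1_N` (for invertible `S`). [folklore] -/
theorem inv_kronecker_one [Fintype X] [Fintype ι] [DecidableEq X] [DecidableEq ι] {S : Matrix X X ℝ}
    (hS : IsUnit S.det) : (S ⊗ₖ (1 : Matrix ι ι ℝ))⁻¹ = S⁻¹ ⊗ₖ (1 : Matrix ι ι ℝ) := by
  apply Matrix.inv_eq_right_inv
  rw [← Matrix.mul_kronecker_mul, Matrix.mul_nonsing_inv S hS, Matrix.mul_one, Matrix.one_kronecker_one]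

/-- **THE ZERO-FIELD GREEN'S FUNCTION IS `N` COPIES OF THE SCALAR ONE**: `G = (scalar H)^{-1} ⊗ 1_N`.
[cite: Balaban1983RegularityDecay, p. 582] -/
theorem green_trivial [Fintype X] [Fintype Y] [Fintype ι] [DecidableEq X] [DecidableEq ι] (c : X → X → ℝ)
    (m2 a : ℝ) (q : Y → X → ℝ) (hS : IsUnit (scalarOp c m2 a q).det) :
    green c m2 a q (fun _ _ => (1 : Matrix ι ι ℝ)) (fun _ _ => (1 : Matrix ι ι ℝ))
      = (scalarOp c m2 a q)⁻¹ ⊗ₖ (1 : Matrix ι ι ℝ) := by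
  rw [green, covOp_trivial, inv_kronecker_one hS]

end Kernels

section B4Links

variable {X Y ι : Type*}

/-! ## §6 [B4]'s link variables `U(A_b) = exp(qeηA_b)` (1.2): one-parameter orthogonal groups, bond functions,
the lattice gauge transformation `A ↦ A − ∂λ`, and CONSTANT FIELDS ARE PURE GAUGES -/

/-- [B4] (1.2): «`U(A) = e^{qeηA}`, `q` is an antisymmetric `N × N` matrix, where `e` is a real parameter» — all link
variables lie in the ONE-PARAMETER ORTHOGONAL GROUP `t ↦ e^{tq}`. We record exactly the three properties of
`t ↦ U(t)` that the gauge algebra uses (`U(0) = 1`, `U(s+t) = U(s)U(t)`, `U(t)ᵀU(t) = 1`); `OrthFlow.rot` below is the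
`N = 2` instance `q = [[0,−1],[1,0]]`. [cite: Balaban1983RegularityDecay, p. 572 (1.2), dictionary] -/
structure OrthFlow (ι : Type*) [Fintype ι] [DecidableEq ι] where
  /-- the group homomorphism `t ↦ U(t)` (`= e^{tq}`) -/
  U : ℝ → Matrix ι ι ℝ
  /-- `U(0) = 1` -/
  map_zero : U 0 = 1
  /-- `U(s + t) = U(s)U(t)` -/
  map_add : ∀ s t, U (s + t) = U s * U t
  /-- `U(t)` is orthogonal -/
  orth : ∀ t, (U t)ᵀ * U t = 1

namespace OrthFlow

variable [Fintype ι] [DecidableEq ι] (F : OrthFlow ι)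

/-- the flow is commutative. [folklore] -/
theorem comm (s t : ℝ) : F.U s * F.U t = F.U t * F.U s := by
  rw [← F.map_add, add_comm, F.map_add]

/-- `U(−t)U(t) = 1`. [folklore] -/
theorem neg_mul_self (t : ℝ) : F.U (-t) * F.U t = 1 := by
  rw [← F.map_add, neg_add_cancel, F.map_zero]

/-- `U(t)ᵀ = U(−t)` (`= U(t)^{-1}`). [folklore] -/
theorem transpose_eq (t : ℝ) : (F.U t)ᵀ = F.U (-t) :=
  Matrix.left_inv_eq_left_inv (F.orth t) (F.neg_mul_self t)

/-- every `x ↦ U(σ(x))` is a gauge transformation. [folklore] -/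
theorem isGauge (σ : X → ℝ) : IsGauge fun x => F.U (σ x) :=
  fun x => F.orth (σ x)

/-- the KEY IDENTITY behind gauge covariance of `U(A_b)`: `U(a + s − t) = U(s)·U(a)·U(t)ᵀ`. [folklore] -/
theorem U_add_sub (a s t : ℝ) : F.U (a + s - t) = F.U s * F.U a * (F.U t)ᵀ := by
  rw [F.transpose_eq, sub_eq_add_neg, F.map_add, F.map_add, F.comm a s]

/-- the ROTATION FLOW of `ℝ²`: `U(t) = [[cos t, −sin t],[sin t, cos t]] = e^{tq}`, `q = [[0,−1],[1,0]]` — the `N = 2`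
(complex scalar, abelian Higgs) instance of (1.2). [cite: Balaban1983RegularityDecay, p. 572 (1.2), dictionary] -/
noncomputable def rot : OrthFlow (Fin 2) where
  U t := !![Real.cos t, -Real.sin t; Real.sin t, Real.cos t]
  map_zero := by
    ext i j
    fin_cases i <;> fin_cases j <;> simp
  map_add s t := by
    ext i j
    fin_cases i <;> fin_cases j <;>
      simp [Matrix.mul_apply, Fin.sum_univ_two, Real.cos_add, Real.sin_add] <;> ring
  orth t := by
    ext i j
    fin_cases i <;> fin_cases j <;> simp [Matrix.mul_apply, Fin.sum_univ_two] <;>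
      nlinarith [Real.sin_sq_add_cos_sq t]

/-- the rotation flow is non-trivial: `U(π) = −1 ≠ 1`. [folklore] -/
theorem rot_ne_one : rot.U Real.pi ≠ 1 := by
  intro h
  have h00 := congrFun (congrFun h 0) 0
  simp [rot] at h00
  norm_num at h00

end OrthFlow

/-- [B4] p. 572 (paraphrase): vector fields are real-valued functions on the bonds `⟨x, x'⟩`, identified with
vector-valued functions on sites by `A_{⟨x,x+ηe_μ⟩} = A_μ(x)`, and «`A(Γ) = Σ_{b⊂Γ} A_b`» with the orientations of
the bonds agreeing with that of `Γ` (`−A_b` for an oppositely oriented bond: the standard reading, not printed) —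
we take a vector field as a function on ORDERED PAIRS of sites (`A(u,v)`, antisymmetric in [B4]; pairs that are
not bonds carry weight `0` in `−Δ_A`), and (1.2) THE LINK VARIABLES `U(A_b) = U(κA_b)`, `κ = eη`.
[cite: Balaban1983RegularityDecay, p. 572 (1.2)] -/
def fieldLink [Fintype ι] [DecidableEq ι] (F : OrthFlow ι) (κ : ℝ) (A : X → X → ℝ) : X → X → Matrix ι ι ℝ :=
  fun u v => F.U (κ * A u v)

/-- THE LATTICE GAUGE TRANSFORMATION of a vector field by `σ : sites → ℝ`: `A^σ(u,v) = A(u,v) + σ(u) − σ(v)`; on the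
bond `⟨x, x + ηe_μ⟩` this reads `A^σ_μ(x) = A_μ(x) − η(∂^η_μσ)(x)`, i.e. `A ↦ A − ∂^ησ` (DICTIONARY: [B4] uses «the
gauge transformation» of [2] without displaying it; this is the standard form under which (1.3)–(1.6) are
covariant, cf. p. 587 «ψ(y) → U(A(Γ_{y,z}))ψ(y)»). [cite: Balaban1983RegularityDecay, pp. 580–581, dictionary] -/
def bondGauge (σ : X → ℝ) (A : X → X → ℝ) : X → X → ℝ :=
  fun u v => A u v + σ u - σ v

/-- **GAUGE TRANSFORMING THE FIELD GAUGES THE LINK VARIABLES**: `U(A^σ_b) = U(κσ(b₋))·U(A_b)·U(κσ(b₊))ᵀ`.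
[folklore] -/
theorem fieldLink_bondGauge [Fintype ι] [DecidableEq ι] (F : OrthFlow ι) (κ : ℝ) (σ : X → ℝ)
    (A : X → X → ℝ) :
    fieldLink F κ (bondGauge σ A)
      = gaugeKer (fun u => F.U (κ * σ u)) (fun u => F.U (κ * σ u)) (fieldLink F κ A) := by
  funext u v
  simp only [fieldLink, bondGauge, gaugeKer_apply]
  rw [show κ * (A u v + σ u - σ v) = κ * A u v + κ * σ u - κ * σ v by ring, F.U_add_sub]

/-- the ZERO FIELD has trivial link variables. [folklore] -/
theorem fieldLink_zero [Fintype ι] [DecidableEq ι] (F : OrthFlow ι) (κ : ℝ) :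
    fieldLink F κ (0 : X → X → ℝ) = fun _ _ => 1 := by
  funext u v
  simp [fieldLink, F.map_zero]

variable {d : ℕ}

/-- a CONSTANT VECTOR FIELD `A_μ(x) ≡ A₀,μ` on sites with integer coordinates `pos : X → ℤ^{d+1}` ([B4]: the
`η`-lattice in lattice units), as a bond function: `A₀(u, v) = ⟨A₀, pos v − pos u⟩` (`= A₀,μ` on `⟨x, x + e_μ⟩`,
`= −A₀,μ` on the reversed bond, `= A₀(Γ)` along any lattice contour from `u` to `v`).
[cite: Balaban1983RegularityDecay, p. 581 «constant configurations A₀», dictionary] -/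
def constBond (A₀ : Fin (d + 1) → ℝ) (pos : X → (Fin (d + 1) → ℤ)) : X → X → ℝ :=
  fun u v => ∑ μ, A₀ μ * ((pos v μ : ℝ) - (pos u μ : ℝ))

/-- the LINEAR GAUGE FUNCTION `λ(x) = −⟨A₀, x⟩` that gauges the constant field away. [folklore] -/
def linGauge (A₀ : Fin (d + 1) → ℝ) (pos : X → (Fin (d + 1) → ℤ)) : X → ℝ :=
  fun u => -∑ μ, A₀ μ * (pos u μ : ℝ)

/-- **A CONSTANT FIELD IS A PURE GAUGE**: `A₀ = 0^λ` with the linear `λ = −⟨A₀, ·⟩` (valid on any subset of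
`ηℤ^d` — NOT on a torus, where `λ` is not periodic). [folklore] -/
theorem constBond_eq_bondGauge (A₀ : Fin (d + 1) → ℝ) (pos : X → (Fin (d + 1) → ℤ)) :
    constBond A₀ pos = bondGauge (linGauge A₀ pos) 0 := by
  funext u v
  simp only [constBond, bondGauge, linGauge, Pi.zero_apply, mul_sub, Finset.sum_sub_distrib]
  ring

/-- **THE LINK VARIABLES OF A CONSTANT FIELD ARE GAUGE-TRIVIAL**: `U(A₀(u,v)) = g(u)·1·g(v)ᵀ`,
`g(x) = U(κλ(x))`. [folklore] -/
theorem fieldLink_constBond [Fintype ι] [DecidableEq ι] (F : OrthFlow ι) (κ : ℝ) (A₀ : Fin (d + 1) → ℝ)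
    (pos : X → (Fin (d + 1) → ℤ)) :
    fieldLink F κ (constBond A₀ pos)
      = gaugeKer (fun u => F.U (κ * linGauge A₀ pos u)) (fun u => F.U (κ * linGauge A₀ pos u))
          (fun _ _ => (1 : Matrix ι ι ℝ)) := by
  rw [constBond_eq_bondGauge, fieldLink_bondGauge, fieldLink_zero]

/-! ### [B4]'s operator (1.6) and Green's function as functions of the vector field -/

/-- **[B4]'s OPERATOR `−Δ^{η,N}_{A,Ω} + m² + aP_k(A)` OF (1.6)** for the vector field `A` (bond function), flow `U`,
coupling `κ = eη`, bond weights `c`, block weights `q` and contour system `Γ` (block sites `emb y`).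
[cite: Balaban1983RegularityDecay, p. 572 (1.3)–(1.6)] -/
def b4Op [Fintype X] [Fintype Y] [Fintype ι] [DecidableEq X] [DecidableEq ι] (F : OrthFlow ι) (κ : ℝ)
    (c : X → X → ℝ) (m2 a : ℝ) (q : Y → X → ℝ) (emb : Y → X) (Γ : Y → X → List X) (A : X → X → ℝ) :
    Matrix (X × ι) (X × ι) ℝ :=
  covOp c m2 a q (fieldLink F κ A) (contourTrans (fieldLink F κ A) emb Γ)

/-- **[B4]'s GREEN'S FUNCTION `G_k(Ω, A)` OF (1.6)**. [cite: Balaban1983RegularityDecay, p. 572 (1.6)] -/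
noncomputable def b4Green [Fintype X] [Fintype Y] [Fintype ι] [DecidableEq X] [DecidableEq ι] (F : OrthFlow ι)
    (κ : ℝ) (c : X → X → ℝ) (m2 a : ℝ) (q : Y → X → ℝ) (emb : Y → X) (Γ : Y → X → List X)
    (A : X → X → ℝ) : Matrix (X × ι) (X × ι) ℝ :=
  (b4Op F κ c m2 a q emb Γ A)⁻¹

/-- **GAUGE COVARIANCE OF [B4]'s OPERATOR (1.6)**: `H(A^σ) = 𝒢_σ H(A) 𝒢_σᵀ`, `𝒢_σ = ⊕_x U(κσ(x))`, for every
contour system whose weighted contours `Γ_{y,x}` end at `x`. [folklore] -/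
theorem b4Op_bondGauge [Fintype X] [Fintype Y] [Fintype ι] [DecidableEq X] [DecidableEq Y] [DecidableEq ι]
    (F : OrthFlow ι) (κ : ℝ) (c : X → X → ℝ) (m2 a : ℝ) {q : Y → X → ℝ} {emb : Y → X} {Γ : Y → X → List X}
    (hend : ∀ y x, q y x ≠ 0 → pathEnd (emb y) (Γ y x) = x) (σ : X → ℝ) (A : X → X → ℝ) :
    b4Op F κ c m2 a q emb Γ (bondGauge σ A)
      = blockDiag (fun u => F.U (κ * σ u)) * b4Op F κ c m2 a q emb Γ A * (blockDiag fun u => F.U (κ * σ u))ᵀ := by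
  rw [b4Op, b4Op, fieldLink_bondGauge, covOp_contour_gauge (F.isGauge _) c m2 a hend]

/-- **GAUGE COVARIANCE OF [B4]'s GREEN'S FUNCTION (1.6)**: `G_k(Ω, A^σ) = 𝒢_σ G_k(Ω, A) 𝒢_σᵀ`. [folklore] -/
theorem b4Green_bondGauge [Fintype X] [Fintype Y] [Fintype ι] [DecidableEq X] [DecidableEq Y] [DecidableEq ι]
    (F : OrthFlow ι) (κ : ℝ) (c : X → X → ℝ) (m2 a : ℝ) {q : Y → X → ℝ} {emb : Y → X} {Γ : Y → X → List X}
    (hend : ∀ y x, q y x ≠ 0 → pathEnd (emb y) (Γ y x) = x) (σ : X → ℝ) (A : X → X → ℝ) :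
    b4Green F κ c m2 a q emb Γ (bondGauge σ A)
      = blockDiag (fun u => F.U (κ * σ u)) * b4Green F κ c m2 a q emb Γ A
          * (blockDiag fun u => F.U (κ * σ u))ᵀ := by
  rw [b4Green, b4Green, b4Op_bondGauge F κ c m2 a hend, conj_inv (F.isGauge _)]

/-- **AT `A = 0` [B4]'s OPERATOR IS `N` COPIES OF THE SCALAR ONE**: `H(0) = (scalar H) ⊗ 1_N`.
[cite: Balaban1983RegularityDecay, p. 582] -/
theorem b4Op_zero [Fintype X] [Fintype Y] [Fintype ι] [DecidableEq X] [DecidableEq ι] (F : OrthFlow ι) (κ : ℝ)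
    (c : X → X → ℝ) (m2 a : ℝ) (q : Y → X → ℝ) (emb : Y → X) (Γ : Y → X → List X) :
    b4Op F κ c m2 a q emb Γ 0 = scalarOp c m2 a q ⊗ₖ (1 : Matrix ι ι ℝ) := by
  rw [b4Op, fieldLink_zero, ← covOp_trivial c m2 a q]
  congr 1
  funext y x
  exact transport_one _ _

/-- **«LEMMA 2.2 IN THE CASE OF A CONSTANT CONFIGURATION `A₀` IS EQUIVALENT TO THE CASE OF CONFIGURATION
`A₀ = 0` BY … THE GAUGE TRANSFORMATION»** ([B4] p. 581; also p. 580 «we reduce them to the case `A₀ = 0`»), AT THE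
LEVEL OF OPERATORS: `H(A₀) = 𝒢 (H_scalar ⊗ 1_N) 𝒢ᵀ` with the explicit gauge `𝒢 = ⊕_x U(−κ⟨A₀, x⟩)`, on ANY finite
set of lattice sites (boxes, their unions — not tori). [cite: Balaban1983RegularityDecay, p. 581] -/
theorem b4Op_constBond [Fintype X] [Fintype Y] [Fintype ι] [DecidableEq X] [DecidableEq Y] [DecidableEq ι]
    (F : OrthFlow ι) (κ : ℝ) (c : X → X → ℝ) (m2 a : ℝ) {q : Y → X → ℝ} {emb : Y → X} {Γ : Y → X → List X}
    (hend : ∀ y x, q y x ≠ 0 → pathEnd (emb y) (Γ y x) = x) (A₀ : Fin (d + 1) → ℝ)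
    (pos : X → (Fin (d + 1) → ℤ)) :
    b4Op F κ c m2 a q emb Γ (constBond A₀ pos)
      = blockDiag (fun u => F.U (κ * linGauge A₀ pos u)) * (scalarOp c m2 a q ⊗ₖ (1 : Matrix ι ι ℝ))
          * (blockDiag fun u => F.U (κ * linGauge A₀ pos u))ᵀ := by
  rw [constBond_eq_bondGauge, b4Op_bondGauge F κ c m2 a hend, b4Op_zero]

/-- **… AND OF GREEN'S FUNCTIONS: `G_k(Ω, A₀) = 𝒢 (G_k(Ω) ⊗ 1_N) 𝒢ᵀ`** — the constant-field Green's function is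
the zero-field («one-component», p. 582) Green's function dressed with the parallel transporters
`U(κ⟨A₀, x' − x⟩) = U(A₀(Γ_{x,x'}))` (cf. [B4] p. 590: «we can "gauge away" the configuration `A₀` … with
`φ(x), φ(x')` replaced by `φ(x), U(A₀(⟨x,x'⟩))φ(x')`»). [cite: Balaban1983RegularityDecay, pp. 581–582] -/
theorem b4Green_constBond [Fintype X] [Fintype Y] [Fintype ι] [DecidableEq X] [DecidableEq Y] [DecidableEq ι]
    (F : OrthFlow ι) (κ : ℝ) (c : X → X → ℝ) (m2 a : ℝ) {q : Y → X → ℝ} {emb : Y → X} {Γ : Y → X → List X}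
    (hend : ∀ y x, q y x ≠ 0 → pathEnd (emb y) (Γ y x) = x) (A₀ : Fin (d + 1) → ℝ)
    (pos : X → (Fin (d + 1) → ℤ)) (hS : IsUnit (scalarOp c m2 a q).det) :
    b4Green F κ c m2 a q emb Γ (constBond A₀ pos)
      = blockDiag (fun u => F.U (κ * linGauge A₀ pos u)) * ((scalarOp c m2 a q)⁻¹ ⊗ₖ (1 : Matrix ι ι ℝ))
          * (blockDiag fun u => F.U (κ * linGauge A₀ pos u))ᵀ := by
  rw [b4Green, b4Op_constBond F κ c m2 a hend, conj_inv (F.isGauge _), inv_kronecker_one hS]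

/-- **THE BLOCKS OF THE CONSTANT-FIELD GREEN'S FUNCTION**: `G_k(Ω,A₀)((x,i),(x',j)) = G_k(Ω)(x,x')·
(U(κλ(x))U(κλ(x'))ᵀ)_{ij}` — the scalar Green's function times an ORTHOGONAL parallel transporter. [folklore] -/
theorem b4Green_constBond_apply [Fintype X] [Fintype Y] [Fintype ι] [DecidableEq X] [DecidableEq Y]
    [DecidableEq ι] (F : OrthFlow ι) (κ : ℝ) (c : X → X → ℝ) (m2 a : ℝ) {q : Y → X → ℝ} {emb : Y → X}
    {Γ : Y → X → List X} (hend : ∀ y x, q y x ≠ 0 → pathEnd (emb y) (Γ y x) = x) (A₀ : Fin (d + 1) → ℝ)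
    (pos : X → (Fin (d + 1) → ℤ)) (hS : IsUnit (scalarOp c m2 a q).det) (x x' : X) (i j : ι) :
    b4Green F κ c m2 a q emb Γ (constBond A₀ pos) (x, i) (x', j)
      = (scalarOp c m2 a q)⁻¹ x x'
          * (F.U (κ * linGauge A₀ pos x) * (F.U (κ * linGauge A₀ pos x'))ᵀ) i j := by
  rw [b4Green_constBond F κ c m2 a hend A₀ pos hS, ← blockOp_smul_one, ← blockOp_gaugeKer, blockOp_apply,
    gaugeKer_apply, Matrix.mul_smul, Matrix.mul_one, Matrix.smul_mul, Matrix.smul_apply, smul_eq_mul]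

/-- entries of an orthogonal matrix are bounded by `1`. [folklore] -/
theorem abs_apply_le_one_of_orthogonal [Fintype ι] [DecidableEq ι] {O : Matrix ι ι ℝ} (hO : Oᵀ * O = 1)
    (i j : ι) : |O i j| ≤ 1 := by
  have h1 : ∑ k, O k j * O k j = 1 := by
    have := congrFun (congrFun hO j) j
    simpa [Matrix.mul_apply, Matrix.one_apply] using this
  have h2 : O i j * O i j ≤ ∑ k, O k j * O k j :=
    Finset.single_le_sum (f := fun k => O k j * O k j) (fun k _ => mul_self_nonneg (O k j)) (Finset.mem_univ i)
  rw [h1] at h2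
  exact abs_le_one_iff_mul_self_le_one.2 h2

/-- **THE CONSTANT-FIELD GREEN'S FUNCTION IS DOMINATED ENTRYWISE BY THE ZERO-FIELD ONE**:
`|G_k(Ω,A₀)((x,i),(x',j))| ≤ |G_k(Ω)(x,x')|` — so every kernel bound for `A = 0` ((1.10), (2.17), Corollary 2.3 at
`A = 0` …) transfers verbatim to constant configurations. [folklore] -/
theorem abs_b4Green_constBond_le [Fintype X] [Fintype Y] [Fintype ι] [DecidableEq X] [DecidableEq Y]
    [DecidableEq ι] (F : OrthFlow ι) (κ : ℝ) (c : X → X → ℝ) (m2 a : ℝ) {q : Y → X → ℝ} {emb : Y → X}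
    {Γ : Y → X → List X} (hend : ∀ y x, q y x ≠ 0 → pathEnd (emb y) (Γ y x) = x) (A₀ : Fin (d + 1) → ℝ)
    (pos : X → (Fin (d + 1) → ℤ)) (hS : IsUnit (scalarOp c m2 a q).det) (x x' : X) (i j : ι) :
    |b4Green F κ c m2 a q emb Γ (constBond A₀ pos) (x, i) (x', j)| ≤ |(scalarOp c m2 a q)⁻¹ x x'| := by
  rw [b4Green_constBond_apply F κ c m2 a hend A₀ pos hS, abs_mul]
  have hO : (F.U (κ * linGauge A₀ pos x) * (F.U (κ * linGauge A₀ pos x'))ᵀ)ᵀ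
      * (F.U (κ * linGauge A₀ pos x) * (F.U (κ * linGauge A₀ pos x'))ᵀ) = 1 := by
    rw [Matrix.transpose_mul, Matrix.transpose_transpose, Matrix.mul_assoc, ← Matrix.mul_assoc (F.U _)ᵀ (F.U _),
      F.orth, Matrix.one_mul, mul_eq_one_comm.1 (F.orth _)]
  exact mul_le_of_le_one_right (abs_nonneg _) (abs_apply_le_one_of_orthogonal hO i j)

end B4Links

section B4Box

/-! ## §7 DICTIONARY WITH THE LINEAGE'S ZERO-FIELD BOX PROPAGATOR: [B4]'s (1.6) on a fine box `Π[0, n·M_μ)` at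
`A = 0` is `B4BoxCov237.boxOpR ⊗ 1_N`; at a CONSTANT field it is its gauge conjugate, and THEOREM (1.10) for boxes
transfers from `A = 0` (`B4Thm110ZeroBox`) to constant configurations `A₀` -/

open Literature.MathematicalPhysics.QuantumFieldTheory.Balaban1983to89.B4Reflection242
  (boxDom nbrs blk mem_boxDom nbrs_comm not_mem_nbrs_self blk_mem_boxDom neumannLapK diagK avgK)
open Literature.MathematicalPhysics.QuantumFieldTheory.Balaban1983to89.B4BoxCov237
  (opBoxR boxOpR boxOpR_det_isUnit)
open Literature.MathematicalPhysics.QuantumFieldTheory.Balaban1983to89.B4ContourShift (supNorm)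
open Literature.MathematicalPhysics.QuantumFieldTheory.Balaban1983to89.B4Thm110ZeroBox
  (roww mulVec_le_of_roww thm110_zero_box_roww_coeff)

variable {ι : Type*} {d : ℕ}

/-- [B4]'s BOND WEIGHTS of (1.3) on a box of the unit lattice `ℤ^{d+1}` that carries `n = L^k = η^{-1}` points per
unit length (lattice units of the lineage, `B4BoxCov237`): `η^{-2} = n²` per nearest-neighbour bond INSIDE the box
(NEUMANN: no bonds leave `Ω = □`), split evenly over the two orientations of each bond (for link variables with
`W(y,x) = W(x,y)ᵀ`, e.g. `U(κA)` with antisymmetric `A`, the two oriented terms of (1.3) coincide).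
[cite: Balaban1983RegularityDecay, p. 572 (1.3), dictionary] -/
noncomputable def boxWt (n : ℕ) (N : Fin (d + 1) → ℕ) : ↥(boxDom N) → ↥(boxDom N) → ℝ :=
  fun x y => (n : ℝ) ^ 2 / 2 * (if y.1 ∈ nbrs x.1 then 1 else 0)

/-- [B4]'s BLOCK WEIGHTS of (1.4): `q(y, x) = 1[x ∈ B(y)]`, `B(y)` = the `n`-block of fine points with block index
`y` (the normalising powers of `η` and `L^kη` in (1.4)–(1.5) are carried by the coefficient `a·n^{-(d+1)}`, as in
`boxOpR`). [cite: Balaban1983RegularityDecay, p. 572 (1.4)–(1.5), dictionary] -/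
noncomputable def blkWt (n : ℕ) (M N : Fin (d + 1) → ℕ) : ↥(boxDom M) → ↥(boxDom N) → ℝ :=
  fun y x => if blk n x.1 = y.1 then 1 else 0

/-- total incoming bond weight at a site `= (n²/2)·#{neighbours in the box}`. [folklore] -/
theorem sum_boxWt_left (n : ℕ) (N : Fin (d + 1) → ℕ) (z : ↥(boxDom N)) :
    ∑ x, boxWt n N x z = (n : ℝ) ^ 2 / 2 * (((nbrs z.1).filter fun w => w ∈ boxDom N).card : ℝ) := by
  unfold boxWt
  rw [← Finset.mul_sum, Finset.sum_coe_sort (s := boxDom N) (f := fun w => if z.1 ∈ nbrs w then (1 : ℝ) else 0),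
    Finset.sum_boole]
  congr 3
  ext w
  simp only [Finset.mem_filter]
  exact ⟨fun h => ⟨nbrs_comm.1 h.2, h.1⟩, fun h => ⟨h.2, nbrs_comm.2 h.1⟩⟩

/-- total outgoing bond weight at a site `= (n²/2)·#{neighbours in the box}`. [folklore] -/
theorem sum_boxWt_right (n : ℕ) (N : Fin (d + 1) → ℕ) (z : ↥(boxDom N)) :
    ∑ y, boxWt n N z y = (n : ℝ) ^ 2 / 2 * (((nbrs z.1).filter fun w => w ∈ boxDom N).card : ℝ) := by
  unfold boxWt
  rw [← Finset.mul_sum, Finset.sum_coe_sort (s := boxDom N) (f := fun w => if w ∈ nbrs z.1 then (1 : ℝ) else 0),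
    Finset.sum_boole]
  congr 3
  ext w
  simp only [Finset.mem_filter]
  exact ⟨fun h => ⟨h.2, h.1⟩, fun h => ⟨h.2, h.1⟩⟩

/-- `Σ_y q(y,z)q(y,z') = 1[blk z = blk z']` (the block of a fine box point is a unit box point). [folklore] -/
theorem sum_blkWt {n : ℕ} {M N : Fin (d + 1) → ℕ} {z : ↥(boxDom N)} (hz : blk n z.1 ∈ boxDom M)
    (z' : ↥(boxDom N)) :
    ∑ y, blkWt n M N y z * blkWt n M N y z' = if blk n z'.1 = blk n z.1 then 1 else 0 := by
  unfold blkWt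
  rw [Finset.sum_coe_sort (s := boxDom M)
    (f := fun w => (if blk n z.1 = w then (1 : ℝ) else 0) * (if blk n z'.1 = w then 1 else 0))]
  simp_rw [ite_mul, one_mul, zero_mul]
  rw [Finset.sum_ite_eq, if_pos hz]

/-- **DICTIONARY THEOREM**: the scalar part of [B4]'s operator (1.6) on the fine box `Π[0, n·M_μ)` with the weights
`boxWt`, `blkWt`, mass `m²` and averaging coefficient `a·n^{-(d+1)}` IS the lineage's real box operator
`B4BoxCov237.boxOpR n a m² M = n²(−Δ^N_□) + m² + (a/n^{d+1})·1_{same block}`. [folklore] -/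
theorem scalarOp_box {n : ℕ} (hn : 1 ≤ n) (a m2 : ℝ) (M : Fin (d + 1) → ℕ) :
    scalarOp (boxWt n (fun i => n * M i)) m2 (a * ((n : ℝ) ^ (d + 1))⁻¹) (blkWt n M (fun i => n * M i))
      = boxOpR n a m2 M := by
  ext z z'
  rw [scalarOp, Matrix.of_apply, sum_boxWt_left, sum_boxWt_right, sum_blkWt (blk_mem_boxDom hn z.2)]
  simp only [boxOpR, opBoxR, Matrix.of_apply, neumannLapK, diagK, avgK, boxWt]
  by_cases h : z = z'
  · subst h
    simp [not_mem_nbrs_self]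
    ring
  · have h1 : z'.1 ≠ z.1 := fun e => h (Subtype.ext e).symm
    have hc : (z.1 ∈ nbrs z'.1) = (z'.1 ∈ nbrs z.1) := propext nbrs_comm
    simp only [h, h1, if_false, hc, zero_sub, sub_zero, zero_add]
    split_ifs <;> ring

/-- the admissibility hypothesis on contour systems is met, e.g. by direct transport `Γ_{y,x} = (emb y → x)` (for
the constant and zero fields every contour from `emb y` to `x` gives the same transporter `U(κ⟨A₀, x − emb y⟩)`;
[B4] p. 572 takes for `Γ^{(k)}_{y,x}` oriented contours in `B^k(y)` from `y` to `x` — paraphrase). [folklore] -/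
theorem pathEnd_direct {X Y : Type*} (emb : Y → X) (q : Y → X → ℝ) :
    ∀ y x, q y x ≠ 0 → pathEnd (emb y) ((fun (_ : Y) (x : X) => [x]) y x) = x :=
  fun _ _ _ => rfl

/-- **[B4]'s GREEN'S FUNCTION (1.6) ON A FINE BOX AT A CONSTANT CONFIGURATION, IN CLOSED FORM**:
`G_k(□, A₀)((x,i),(x',j)) = (boxOpR n a m² M)^{-1}(x,x') · (U(κλ(x))U(κλ(x'))ᵀ)_{ij}`, `λ = −⟨A₀, ·⟩` — the
lineage's zero-field box propagator dressed with orthogonal parallel transporters ([B4] p. 581 «equivalent to the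
case of configuration A₀ = 0», p. 582 «G_k(□,0) = G_k(□)1»). [cite: Balaban1983RegularityDecay, pp. 581–582] -/
theorem b4Green_constBond_box_apply [Fintype ι] [DecidableEq ι] (F : OrthFlow ι) (κ : ℝ) {n : ℕ} (hn : 1 ≤ n)
    {a m2 : ℝ} (ha : 0 < a) (hm : 0 ≤ m2) {M : Fin (d + 1) → ℕ} (hM : ∀ i, 1 ≤ M i)
    {emb : ↥(boxDom M) → ↥(boxDom (fun i => n * M i))}
    {Γ : ↥(boxDom M) → ↥(boxDom (fun i => n * M i)) → List ↥(boxDom (fun i => n * M i))}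
    (hend : ∀ y x, blkWt n M (fun i => n * M i) y x ≠ 0 → pathEnd (emb y) (Γ y x) = x)
    (A₀ : Fin (d + 1) → ℝ) (x x' : ↥(boxDom (fun i => n * M i))) (i j : ι) :
    b4Green F κ (boxWt n (fun i => n * M i)) m2 (a * ((n : ℝ) ^ (d + 1))⁻¹) (blkWt n M (fun i => n * M i))
        emb Γ (constBond A₀ Subtype.val) (x, i) (x', j)
      = (boxOpR n a m2 M)⁻¹ x x'
          * (F.U (κ * linGauge A₀ Subtype.val x) * (F.U (κ * linGauge A₀ Subtype.val x'))ᵀ) i j := by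
  have hS : IsUnit (scalarOp (boxWt n (fun i => n * M i)) m2 (a * ((n : ℝ) ^ (d + 1))⁻¹)
      (blkWt n M (fun i => n * M i))).det := by
    rw [scalarOp_box hn]
    exact boxOpR_det_isUnit hn ha hm hM
  rw [b4Green_constBond_apply F κ _ m2 _ hend A₀ _ hS, scalarOp_box hn]

/-- **THEOREM (1.10) FOR BOXES AT CONSTANT CONFIGURATIONS `A₀`** (entrywise in colour): with the constants
`δ₀, c₀` of the zero-field theorem `B4Thm110ZeroBox.thm110_zero_box_roww_coeff` — uniformly in `k ≥ 1`, in
`(a, m²)` in the window, in the box and in `A₀` — `Σ_{x′∈□} |G_k(□, A₀)((x,i),(x′,j))|·e^{δ₀ dist(x,x′)} ≤ c₀`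
([B4] p. 581: the constant-configuration case «is equivalent to the case of configuration A₀ = 0 by the same
argument with the gauge transformation»). HONEST LABEL: (1.10) itself is for arbitrary (regular) `A`; this is its
constant-field case on boxes, obtained from the lineage's `A = 0` theorem by the printed gauge reduction.
[cite: Balaban1983RegularityDecay, p. 573 (1.10) with p. 581] -/
theorem thm110_const_box_roww [Fintype ι] [DecidableEq ι] (F : OrthFlow ι) (κ : ℝ) (d ℓ : ℕ) (hℓ : 1 ≤ ℓ)
    (amin aplus m2plus : ℝ) (ha : 0 < amin) :
    ∃ δ₀ c₀ : ℝ, 0 < δ₀ ∧ 0 < c₀ ∧ ∀ (k : ℕ), 1 ≤ k → ∀ (a m2 : ℝ), amin ≤ a → a ≤ aplus → 0 ≤ m2 →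
      m2 ≤ m2plus → ∀ (M : Fin (d + 1) → ℕ), (∀ i, 1 ≤ M i) →
      ∀ (emb : ↥(boxDom M) → ↥(boxDom (fun i => (ℓ + 1) ^ k * M i)))
        (Γ : ↥(boxDom M) → ↥(boxDom (fun i => (ℓ + 1) ^ k * M i)) → List ↥(boxDom (fun i => (ℓ + 1) ^ k * M i))),
        (∀ y x, blkWt ((ℓ + 1) ^ k) M (fun i => (ℓ + 1) ^ k * M i) y x ≠ 0 → pathEnd (emb y) (Γ y x) = x) →
      ∀ (A₀ : Fin (d + 1) → ℝ) (x : ↥(boxDom (fun i => (ℓ + 1) ^ k * M i))) (i j : ι),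
        ∑ x', |b4Green F κ (boxWt ((ℓ + 1) ^ k) (fun i => (ℓ + 1) ^ k * M i)) m2
                  (a * ((((ℓ + 1) ^ k : ℕ) : ℝ) ^ (d + 1))⁻¹) (blkWt ((ℓ + 1) ^ k) M (fun i => (ℓ + 1) ^ k * M i))
                  emb Γ (constBond A₀ Subtype.val) (x, i) (x', j)|
            * Real.exp (δ₀ * supNorm (x.1 - x'.1) / (((ℓ + 1) ^ k : ℕ) : ℝ)) ≤ c₀ := by
  obtain ⟨δ₀, c₀, hδ0, hc0, h⟩ := thm110_zero_box_roww_coeff d ℓ hℓ amin aplus m2plus ha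
  refine ⟨δ₀, c₀, hδ0, hc0, ?_⟩
  intro k hk a m2 h1 h2 h3 h4 M hM emb Γ hend A₀ x i j
  have hn : 1 ≤ (ℓ + 1) ^ k := Nat.one_le_pow k (ℓ + 1) (Nat.succ_pos ℓ)
  have ha' : 0 < a := lt_of_lt_of_le ha h1
  have hS : IsUnit (scalarOp (boxWt ((ℓ + 1) ^ k) (fun i => (ℓ + 1) ^ k * M i)) m2
      (a * ((((ℓ + 1) ^ k : ℕ) : ℝ) ^ (d + 1))⁻¹) (blkWt ((ℓ + 1) ^ k) M (fun i => (ℓ + 1) ^ k * M i))).det := by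
    rw [scalarOp_box hn]
    exact boxOpR_det_isUnit hn ha' h3 hM
  refine le_trans (Finset.sum_le_sum fun x' _ => mul_le_mul_of_nonneg_right
    (abs_b4Green_constBond_le F κ _ m2 _ hend A₀ _ hS x x' i j) (Real.exp_pos _).le) ?_
  rw [scalarOp_box hn]
  exact h k hk a m2 h1 h2 h3 h4 M hM x

/-- **… AND THE PRINTED VALUE CLAUSE OF (1.10) AT CONSTANT `A₀`, COMPONENTWISE**: for `f : □ → R^N` with
`|f_j(x′)| ≤ F_b` and `D ≤ |x − x′|_∞` on `supp f` (fine-lattice units, `e^{−δ₀D/L^k} = e^{−δ₀ dist_η}`):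
`|(G_k(□, A₀)f)_i(x)| ≤ N·c₀·e^{−δ₀D/L^k}·F_b` (the factor `N = card ι` is the price of the componentwise sup-norm; cf.
`B4Thm110ZeroBox.thm110_zero_box_value_coeff` at `A = 0`). [cite: Balaban1983RegularityDecay, p. 573 (1.10) with p. 581] -/
theorem thm110_const_box_value [Fintype ι] [DecidableEq ι] (F : OrthFlow ι) (κ : ℝ) (d ℓ : ℕ) (hℓ : 1 ≤ ℓ)
    (amin aplus m2plus : ℝ) (ha : 0 < amin) :
    ∃ δ₀ c₀ : ℝ, 0 < δ₀ ∧ 0 < c₀ ∧ ∀ (k : ℕ), 1 ≤ k → ∀ (a m2 : ℝ), amin ≤ a → a ≤ aplus → 0 ≤ m2 →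
      m2 ≤ m2plus → ∀ (M : Fin (d + 1) → ℕ), (∀ i, 1 ≤ M i) →
      ∀ (emb : ↥(boxDom M) → ↥(boxDom (fun i => (ℓ + 1) ^ k * M i)))
        (Γ : ↥(boxDom M) → ↥(boxDom (fun i => (ℓ + 1) ^ k * M i)) → List ↥(boxDom (fun i => (ℓ + 1) ^ k * M i))),
        (∀ y x, blkWt ((ℓ + 1) ^ k) M (fun i => (ℓ + 1) ^ k * M i) y x ≠ 0 → pathEnd (emb y) (Γ y x) = x) →
      ∀ (A₀ : Fin (d + 1) → ℝ) (f : ↥(boxDom (fun i => (ℓ + 1) ^ k * M i)) × ι → ℝ) (Fb D : ℝ),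
        (∀ p, |f p| ≤ Fb) → ∀ x : ↥(boxDom (fun i => (ℓ + 1) ^ k * M i)),
        (∀ x' j, f (x', j) ≠ 0 → D ≤ supNorm (x.1 - x'.1)) → ∀ i : ι,
        |(b4Green F κ (boxWt ((ℓ + 1) ^ k) (fun i => (ℓ + 1) ^ k * M i)) m2
              (a * ((((ℓ + 1) ^ k : ℕ) : ℝ) ^ (d + 1))⁻¹) (blkWt ((ℓ + 1) ^ k) M (fun i => (ℓ + 1) ^ k * M i))
              emb Γ (constBond A₀ Subtype.val) *ᵥ f) (x, i)|
          ≤ Fintype.card ι * (c₀ * Real.exp (-(δ₀ * D / (((ℓ + 1) ^ k : ℕ) : ℝ))) * Fb) := by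
  obtain ⟨δ₀, c₀, hδ0, hc0, h⟩ := thm110_const_box_roww F κ d ℓ hℓ amin aplus m2plus ha
  refine ⟨δ₀, c₀, hδ0, hc0, ?_⟩
  intro k hk a m2 h1 h2 h3 h4 M hM emb Γ hend A₀ f Fb D hF x hD i
  rw [mulVec_apply_colour]
  refine (Finset.abs_sum_le_sum_abs _ _).trans ?_
  refine (Finset.sum_le_sum (g := fun _ => c₀ * Real.exp (-(δ₀ * D / (((ℓ + 1) ^ k : ℕ) : ℝ))) * Fb)
    fun j _ => ?_).trans (le_of_eq ?_)
  · exact mulVec_le_of_roww hδ0.le ((ℓ + 1) ^ k) _ x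
      (by simpa only [roww, Matrix.of_apply] using h k hk a m2 h1 h2 h3 h4 M hM emb Γ hend A₀ x i j)
      _ (fun z' => hF (z', j)) (fun z' hz => hD z' j hz)
  · rw [Finset.sum_const, Finset.card_univ, nsmul_eq_mul]

/-! ### Non-vacuity: the hypotheses are met (`d + 1 = 4`, `L = 2`, `N = 2` with the rotation flow, window
`a ∈ [1/2, 2]`, `m² ∈ [0, 1]`; admissible contour systems exist on every box) -/

/-- the constant-field theorem instantiated at the physical dimension with the `N = 2` rotation flow. -/
example (κ : ℝ) : True := by
  have := thm110_const_box_roww OrthFlow.rot κ 3 1 le_rfl (1 / 2) 2 1 (by norm_num)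
  have := thm110_const_box_value OrthFlow.rot κ 3 1 le_rfl (1 / 2) 2 1 (by norm_num)
  trivial

/-- admissible contour systems exist on every fine box over a box of unit blocks (direct transport from a base
point), so the `emb, Γ, hend` binders of the theorems above are inhabited. -/
example (ℓ k : ℕ) (M : Fin (d + 1) → ℕ) (hM : ∀ i, 1 ≤ M i) :
    ∃ (emb : ↥(boxDom M) → ↥(boxDom (fun i => (ℓ + 1) ^ k * M i)))
      (Γ : ↥(boxDom M) → ↥(boxDom (fun i => (ℓ + 1) ^ k * M i)) → List ↥(boxDom (fun i => (ℓ + 1) ^ k * M i))),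
      ∀ y x, blkWt ((ℓ + 1) ^ k) M (fun i => (ℓ + 1) ^ k * M i) y x ≠ 0 → pathEnd (emb y) (Γ y x) = x := by
  have h0 : (fun _ => (0 : ℤ)) ∈ boxDom (fun i => (ℓ + 1) ^ k * M i) :=
    mem_boxDom.2 fun i => ⟨le_rfl, by exact_mod_cast Nat.mul_pos (pow_pos (Nat.succ_pos ℓ) k) (hM i)⟩
  exact ⟨fun _ => ⟨_, h0⟩, fun _ x => [x], fun _ _ _ => rfl⟩

end B4Box

end Literature.MathematicalPhysics.QuantumFieldTheory.Balaban1983to89.B4GaugeCovariance
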